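import Literature.Computability.MetaComplexity.LevelledRefutationCNFFill
import HarnessLib

/-!
# Garlík's adversary for `REF^F_{s,t}`: the backward step and the deterministic core

Support file for the proof of `levelledRefCNF_lowerBound` ([Garlík 2019, Thm 1]); third and last
part of the deterministic half of [Garlík 2019, §4]:

* [Garlík 2019, Lemma 19] (`step`): if the conclusion `E` of a resolution inference has a good
  admissible assignment (one extending `ρ`, falsifying `E` where defined and covering `E`),
  then so has one of the premises — provided `E` obeys the width bounds `Narrow P W T E`, the
  restriction `ρ` is `K`-sparse per level, and `2(3K + 7W + T) + 1 ≤ t`;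
* Case 3 of its proof (`exists_setL`, `exists_setR`): extending by a premise
  `L(i,j,·) := j'` / `R(i,j,·) := j'` with a fresh child `(i-1, j')` outside the three
  avoidance sets `U_1, U_2, U_3`;
* the **deterministic core** (`core_contradiction`): an admissible, `K`-sparse `ρ` such that
  every clause of a refutation `π` of (an axiom-shaped CNF such as) `REF^F_{s,t}` is satisfied by
  `ρ` or narrow cannot exist — the backward walk from the empty clause
  ([Garlík 2019, §4, the paragraph before Lemma 16]) — and its specialisation
  `levelledRefCNF_core` to `levelledRefCNF F s t`.

The probabilistic half ([Garlík 2019, Lemmas 10 and 14]: a restriction with these properties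
exists when `|π| ≤ 2^{t^δ}`) is in the companion files.

## References

* M. Garlík, *Resolution lower bounds for refutation statements*, MFCS 2019 / arXiv:1905.12372,
  §4, Lemma 19 and the proof of Theorem 7.
-/

namespace Literature.Computability.MetaComplexity

open _root_.Computability Complexity

namespace LevelledRefCNF

/-! ### Importance after adding one literal -/

section Insert

variable {P : Params} {E : Finset (Literal ℕ)} {l : Literal ℕ}

/-- Adding a literal on a variable outside a group does not change the positive count of that
group. [folklore] -/
theorem posCnt_insert_of_ne {f : ℕ → LRefVar} {N : ℕ} (h : ∀ k < N, l ≠ ((f k).code, true)) :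
    posCnt (insert l E) f N = posCnt E f N := by
  classical
  unfold posCnt
  congr 1
  apply Finset.filter_congr
  intro k hk
  rw [Finset.mem_insert]
  constructor
  · rintro (h' | h')
    · exact absurd h'.symm (h k (Finset.mem_range.1 hk))
    · exact h'
  · exact fun h' => Or.inr h'

/-- Adding a literal that is not a negative literal of a group does not create negative
literals of that group. [folklore] -/
theorem HasNeg.of_insert {f : ℕ → LRefVar} {N : ℕ} (hn : HasNeg (insert l E) f N)
    (h : ∀ k < N, l ≠ ((f k).code, false)) : HasNeg E f N := by
  obtain ⟨k, hk, hm⟩ := hn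
  rw [Finset.mem_insert] at hm
  rcases hm with hm | hm
  · exact absurd hm.symm (h k hk)
  · exact ⟨k, hk, hm⟩

/-- `V`-importance after adding a literal on a variable outside the group. [folklore] -/
theorem VImp.of_insert {i j : ℕ} (hv : VImp P (insert l E) i j)
    (h : ∀ ℓ < P.n, l.1 ≠ (LRefVar.V i j ℓ).code) : VImp P E i j := by
  obtain ⟨h1, hi, hj, hv⟩ := hv
  refine ⟨h1, hi, hj, ?_⟩
  rcases hv with hv | hv
  · exact Or.inl (hv.of_insert fun k hk he => h k hk (by rw [he]))
  · rw [posCnt_insert_of_ne fun k hk he => h k hk (by rw [he])] at hv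
    exact Or.inr hv

/-- `I`-importance after adding a literal on a variable outside the group. [folklore] -/
theorem IImp.of_insert {j : ℕ} (hv : IImp P (insert l E) j)
    (h : ∀ m < P.r, l.1 ≠ (LRefVar.I j m).code) : IImp P E j := by
  obtain ⟨hj, hv⟩ := hv
  refine ⟨hj, ?_⟩
  rcases hv with hv | hv
  · exact Or.inl (hv.of_insert fun k hk he => h k hk (by rw [he]))
  · rw [posCnt_insert_of_ne fun k hk he => h k hk (by rw [he])] at hv
    exact Or.inr hv

/-- `L`-importance after adding a literal on a variable outside the group. [folklore] -/
theorem LImp.of_insert {i j : ℕ} (hv : LImp P (insert l E) i j)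
    (h : ∀ k < P.t, l.1 ≠ (LRefVar.L i j k).code) : LImp P E i j := by
  obtain ⟨h1, hi, hj, hv⟩ := hv
  refine ⟨h1, hi, hj, ?_⟩
  rcases hv with hv | hv
  · exact Or.inl (hv.of_insert fun k hk he => h k hk (by rw [he]))
  · rw [posCnt_insert_of_ne fun k hk he => h k hk (by rw [he])] at hv
    exact Or.inr hv

/-- `R`-importance after adding a literal on a variable outside the group. [folklore] -/
theorem RImp.of_insert {i j : ℕ} (hv : RImp P (insert l E) i j)
    (h : ∀ k < P.t, l.1 ≠ (LRefVar.R i j k).code) : RImp P E i j := by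
  obtain ⟨h1, hi, hj, hv⟩ := hv
  refine ⟨h1, hi, hj, ?_⟩
  rcases hv with hv | hv
  · exact Or.inl (hv.of_insert fun k hk he => h k hk (by rw [he]))
  · rw [posCnt_insert_of_ne fun k hk he => h k hk (by rw [he])] at hv
    exact Or.inr hv

/-- `D`-mention after adding a literal on a variable outside the group. [folklore] -/
theorem DMen.of_insert {i j : ℕ} (hv : DMen P (insert l E) i j)
    (h : ∀ ℓ < P.n, ∀ b, l.1 ≠ (LRefVar.D i j ℓ b).code) : DMen P E i j := by
  obtain ⟨hi, hj, ℓ, hℓ, b, c, hm⟩ := hv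
  rw [Finset.mem_insert] at hm
  rcases hm with hm | hm
  · exact absurd (by rw [← hm]) (h ℓ hℓ b)
  · exact ⟨hi, hj, ℓ, hℓ, b, c, hm⟩

/-- What covering the clause `E ∪ {x^pol}` requires beyond covering `E`: only the group of `x`
(if `x` is in range) may become important. [folklore] -/
def KindCovered (P : Params) (τ : PA) (E' : Finset (Literal ℕ)) : LRefVar → Prop
  | .D i j ℓ _ => i < P.s → j < P.t → ℓ < P.n → τ.D (i, j) ≠ none
  | .V i j ℓ => ℓ < P.n → VImp P E' i j → τ.V (i, j) ≠ none
  | .I j m => m < P.r → IImp P E' j → τ.I j ≠ none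
  | .L i j k => k < P.t → LImp P E' i j → τ.L (i, j) ≠ none
  | .R i j k => k < P.t → RImp P E' i j → τ.R (i, j) ≠ none

/-- **Covering `E ∪ {x^pol}`.** [cite: Garlik2019, Lemma 19 (proof: "(ii) is satisfied by τ
and E ∪ {Q^{1-τ(Q)}}")] -/
theorem Covered.insert_code {τ : PA} (hC : Covered P τ E) (x : LRefVar) (pol : Bool)
    (hx : KindCovered P τ (insert (x.code, pol) E) x) : Covered P τ (insert (x.code, pol) E) := by
  have inj : ∀ {y : LRefVar}, x.code = y.code → x = y := fun h => LRefVar.code_injective h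
  refine ⟨fun i j hm => ?_, fun i j hm => ?_, fun j hm => ?_, fun i j hm => ?_, fun i j hm => ?_⟩
  · by_cases h : ∀ ℓ < P.n, ∀ b, (x.code, pol).1 ≠ (LRefVar.D i j ℓ b).code
    · exact hC.D i j (hm.of_insert h)
    · push Not at h
      obtain ⟨ℓ, hℓ, b, he⟩ := h
      cases inj he
      exact hx hm.1 hm.2.1 hℓ
  · by_cases h : ∀ ℓ < P.n, (x.code, pol).1 ≠ (LRefVar.V i j ℓ).code
    · exact hC.V i j (hm.of_insert h)
    · push Not at h
      obtain ⟨ℓ, hℓ, he⟩ := h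
      cases inj he
      exact hx hℓ hm
  · by_cases h : ∀ m < P.r, (x.code, pol).1 ≠ (LRefVar.I j m).code
    · exact hC.I j (hm.of_insert h)
    · push Not at h
      obtain ⟨m, hm', he⟩ := h
      cases inj he
      exact hx hm' hm
  · by_cases h : ∀ k < P.t, (x.code, pol).1 ≠ (LRefVar.L i j k).code
    · exact hC.L i j (hm.of_insert h)
    · push Not at h
      obtain ⟨k, hk, he⟩ := h
      cases inj he
      exact hx hk hm
  · by_cases h : ∀ k < P.t, (x.code, pol).1 ≠ (LRefVar.R i j k).code
    · exact hC.R i j (hm.of_insert h)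
    · push Not at h
      obtain ⟨k, hk, he⟩ := h
      cases inj he
      exact hx hk hm

/-- Covering `E ∪ {(Q, pol)}` for a junk variable `Q` (not the code of any variable) is
covering `E`. [folklore] -/
theorem Covered.insert_junk {τ : PA} (hC : Covered P τ E) {Q : ℕ} (hQ : ∀ x : LRefVar, x.code ≠ Q)
    (pol : Bool) : Covered P τ (insert (Q, pol) E) := by
  refine ⟨fun i j hm => hC.D i j (hm.of_insert fun ℓ _ b h => hQ _ h.symm),
    fun i j hm => hC.V i j (hm.of_insert fun ℓ _ h => hQ _ h.symm),
    fun j hm => hC.I j (hm.of_insert fun m _ h => hQ _ h.symm),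
    fun i j hm => hC.L i j (hm.of_insert fun k _ h => hQ _ h.symm),
    fun i j hm => hC.R i j (hm.of_insert fun k _ h => hQ _ h.symm)⟩

end Insert

/-! ### From a suitable assignment to goodness of a premise -/

section Finish

variable {P : Params} {Fc : ℕ → Finset (ℕ × Bool)} {ρ τ : PA} {E E₀ E₁ : Finset (Literal ℕ)}
  {Q : ℕ}

/-- The premises of a resolution step are contained in the conclusion plus the pivot literal.
[folklore] -/
theorem subset_insert_of_isResolvent (h : IsResolvent E₀ E₁ Q E) :
    E₀ ⊆ insert (Q, true) E ∧ E₁ ⊆ insert (Q, false) E := by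
  obtain ⟨-, -, rfl⟩ := h
  constructor
  · intro l hl
    rw [Finset.mem_insert, Finset.mem_union]
    by_cases hlq : l = (Q, true)
    · exact Or.inl hlq
    · exact Or.inr (Or.inl (Finset.mem_erase.2 ⟨hlq, hl⟩))
  · intro l hl
    rw [Finset.mem_insert, Finset.mem_union]
    by_cases hlq : l = (Q, false)
    · exact Or.inl hlq
    · exact Or.inr (Or.inr (Finset.mem_erase.2 ⟨hlq, hl⟩))

/-- A good assignment for `E` that covers `E ∪ {(Q, pol)}` and does not give the value `pol` to
the pivot is good for the premise containing `(Q, pol)`. [cite: Garlik2019, Lemma 19 (proof,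
the reduction to "E ∪ {Q^{1-τ(Q)}} in place of E")] -/
theorem good_premise (hτ : Admissible P Fc τ) (hρτ : Ext ρ τ) (hF : Falsi P τ E) {pol : Bool}
    (hCov : Covered P τ (insert (Q, pol) E))
    (hval : ∀ x : LRefVar, x.code = Q → τ.eval P x ≠ some pol) {E' : Finset (Literal ℕ)}
    (hsub : E' ⊆ insert (Q, pol) E) : Good P Fc ρ E' := by
  refine ⟨τ, hτ, hρτ, fun x b hx => ?_, hCov.mono hsub⟩
  have := hsub hx
  rw [Finset.mem_insert] at this
  rcases this with h | h
  · simp only [Prod.mk.injEq] at h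
    obtain ⟨h1, rfl⟩ := h
    exact hval x h1
  · exact hF x b h

/-- **The finishing move of [Garlík 2019, Lemma 19].** Given the resolution step
`E₀, E₁ ⊢ E` on the pivot `Q = code x`, an admissible extension `τ` of `ρ` falsifying `E`
where defined and covering `E`, a polarity `pol` that `τ` does not give to `x`, and the extra
covering required by the literal `x^pol`, one of the premises is good.
[cite: Garlik2019, Lemma 19 (proof)] -/
theorem finish (hres : IsResolvent E₀ E₁ Q E) (hτ : Admissible P Fc τ) (hρτ : Ext ρ τ)
    (hF : Falsi P τ E) (hC : Covered P τ E) {x : LRefVar} (hx : x.code = Q) (pol : Bool)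
    (hk : KindCovered P τ (insert (x.code, pol) E) x) (hv : τ.eval P x ≠ some pol) :
    Good P Fc ρ E₀ ∨ Good P Fc ρ E₁ := by
  have hval : ∀ y : LRefVar, y.code = Q → τ.eval P y ≠ some pol := by
    intro y hy
    rw [← hx] at hy
    rw [LRefVar.code_injective hy]
    exact hv
  have hCov : Covered P τ (insert (Q, pol) E) := by
    rw [← hx]; exact hC.insert_code x pol hk
  obtain ⟨h0, h1⟩ := subset_insert_of_isResolvent hres
  cases pol
  · exact Or.inr (good_premise hτ hρτ hF hCov hval h1)
  · exact Or.inl (good_premise hτ hρτ hF hCov hval h0)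

/-- The finishing move when the group of `x` is set: take `pol` opposite to the value.
[cite: Garlik2019, Lemma 19 (proof: "If Q ∈ dom(σ₁) …")] -/
theorem finish_of_value (hres : IsResolvent E₀ E₁ Q E) (hτ : Admissible P Fc τ) (hρτ : Ext ρ τ)
    (hF : Falsi P τ E) (hC : Covered P τ E) {x : LRefVar} (hx : x.code = Q) {v : Bool}
    (hval : τ.eval P x = some v) (hk : ∀ pol, KindCovered P τ (insert (x.code, pol) E) x) :
    Good P Fc ρ E₀ ∨ Good P Fc ρ E₁ :=
  finish hres hτ hρτ hF hC hx (!v) (hk _) (by rw [hval]; cases v <;> simp)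

/-- The finishing move for a junk pivot. [folklore] -/
theorem finish_junk (hres : IsResolvent E₀ E₁ Q E) (hτ : Admissible P Fc τ) (hρτ : Ext ρ τ)
    (hF : Falsi P τ E) (hC : Covered P τ E) (hQ : ∀ x : LRefVar, x.code ≠ Q) :
    Good P Fc ρ E₀ ∨ Good P Fc ρ E₁ :=
  Or.inl (good_premise hτ hρτ hF (hC.insert_junk hQ true) (fun x hx => absurd hx (hQ x))
    (subset_insert_of_isResolvent hres).1)

end Finish

/-! ### Case 3: adding a premise with a fresh child -/

section AddChild

variable {P : Params} {Fc : ℕ → Finset (ℕ × Bool)} {τ : PA}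

/-- The extension of [Garlík 2019, Lemma 19, Case 3] for `L` on level `1` (paper: `i = 2`):
`L(1,j,·) := j'`, `I(j',·) := m`, `D(0,j',·,·) := CL`. [cite: Garlik2019, Lemma 19 (proof,
Case 3, i = 2)] -/
def PA.addChildL0 (τ : PA) (j j' : ℕ) (CL : Finset (ℕ × Bool)) (m : ℕ) : PA :=
  ((τ.setL (1, j) j').setI j' m).setD (0, j') CL

/-- The extension of [Garlík 2019, Lemma 19, Case 3] for `L` on a level `p + 2 ≥ 2` (paper:
`i ≥ 3`): `L(p+2,j,·) := j'`, `V(p+1,j',·) := ℓ'`, `D(p+1,j',·,·) := CL`.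
[cite: Garlik2019, Lemma 19 (proof, Case 3, i ≥ 3)] -/
def PA.addChildLS (τ : PA) (p j j' : ℕ) (CL : Finset (ℕ × Bool)) (ℓ' : ℕ) : PA :=
  ((τ.setL (p + 2, j) j').setV (p + 1, j') ℓ').setD (p + 1, j') CL

/-- Reading a field after an update (definitional). [folklore] -/
@[simp] theorem PA.addChildL0_D (τ : PA) (j j' : ℕ) (CL : Finset (ℕ × Bool)) (m : ℕ) :
    (τ.addChildL0 j j' CL m).D = Function.update τ.D (0, j') (some CL) := rfl
/-- Reading a field after an update (definitional). [folklore] -/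
@[simp] theorem PA.addChildL0_V (τ : PA) (j j' : ℕ) (CL : Finset (ℕ × Bool)) (m : ℕ) :
    (τ.addChildL0 j j' CL m).V = τ.V := rfl
/-- Reading a field after an update (definitional). [folklore] -/
@[simp] theorem PA.addChildL0_I (τ : PA) (j j' : ℕ) (CL : Finset (ℕ × Bool)) (m : ℕ) :
    (τ.addChildL0 j j' CL m).I = Function.update τ.I j' (some m) := rfl
/-- Reading a field after an update (definitional). [folklore] -/
@[simp] theorem PA.addChildL0_L (τ : PA) (j j' : ℕ) (CL : Finset (ℕ × Bool)) (m : ℕ) :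
    (τ.addChildL0 j j' CL m).L = Function.update τ.L (1, j) (some j') := rfl
/-- Reading a field after an update (definitional). [folklore] -/
@[simp] theorem PA.addChildL0_R (τ : PA) (j j' : ℕ) (CL : Finset (ℕ × Bool)) (m : ℕ) :
    (τ.addChildL0 j j' CL m).R = τ.R := rfl
/-- Reading a field after an update (definitional). [folklore] -/
@[simp] theorem PA.addChildLS_D (τ : PA) (p j j' : ℕ) (CL : Finset (ℕ × Bool)) (ℓ' : ℕ) :
    (τ.addChildLS p j j' CL ℓ').D = Function.update τ.D (p + 1, j') (some CL) := rfl
/-- Reading a field after an update (definitional). [folklore] -/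
@[simp] theorem PA.addChildLS_V (τ : PA) (p j j' : ℕ) (CL : Finset (ℕ × Bool)) (ℓ' : ℕ) :
    (τ.addChildLS p j j' CL ℓ').V = Function.update τ.V (p + 1, j') (some ℓ') := rfl
/-- Reading a field after an update (definitional). [folklore] -/
@[simp] theorem PA.addChildLS_I (τ : PA) (p j j' : ℕ) (CL : Finset (ℕ × Bool)) (ℓ' : ℕ) :
    (τ.addChildLS p j j' CL ℓ').I = τ.I := rfl
/-- Reading a field after an update (definitional). [folklore] -/
@[simp] theorem PA.addChildLS_L (τ : PA) (p j j' : ℕ) (CL : Finset (ℕ × Bool)) (ℓ' : ℕ) :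
    (τ.addChildLS p j j' CL ℓ').L = Function.update τ.L (p + 2, j) (some j') := rfl
/-- Reading a field after an update (definitional). [folklore] -/
@[simp] theorem PA.addChildLS_R (τ : PA) (p j j' : ℕ) (CL : Finset (ℕ × Bool)) (ℓ' : ℕ) :
    (τ.addChildLS p j j' CL ℓ').R = τ.R := rfl

/-- The extension of [Garlík 2019, Lemma 19, Case 3] for `R` on level `1` (paper: `i = 2`):
`R(1,j,·) := j'`, `I(j',·) := m`, `D(0,j',·,·) := CL`. [cite: Garlik2019, Lemma 19 (proof,
Case 3, i = 2)] -/
def PA.addChildR0 (τ : PA) (j j' : ℕ) (CL : Finset (ℕ × Bool)) (m : ℕ) : PA :=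
  ((τ.setR (1, j) j').setI j' m).setD (0, j') CL

/-- The extension of [Garlík 2019, Lemma 19, Case 3] for `R` on a level `p + 2 ≥ 2` (paper:
`i ≥ 3`): `R(p+2,j,·) := j'`, `V(p+1,j',·) := ℓ'`, `D(p+1,j',·,·) := CL`.
[cite: Garlik2019, Lemma 19 (proof, Case 3, i ≥ 3)] -/
def PA.addChildRS (τ : PA) (p j j' : ℕ) (CL : Finset (ℕ × Bool)) (ℓ' : ℕ) : PA :=
  ((τ.setR (p + 2, j) j').setV (p + 1, j') ℓ').setD (p + 1, j') CL

/-- Reading a field after an update (definitional). [folklore] -/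
@[simp] theorem PA.addChildR0_D (τ : PA) (j j' : ℕ) (CL : Finset (ℕ × Bool)) (m : ℕ) :
    (τ.addChildR0 j j' CL m).D = Function.update τ.D (0, j') (some CL) := rfl
/-- Reading a field after an update (definitional). [folklore] -/
@[simp] theorem PA.addChildR0_V (τ : PA) (j j' : ℕ) (CL : Finset (ℕ × Bool)) (m : ℕ) :
    (τ.addChildR0 j j' CL m).V = τ.V := rfl
/-- Reading a field after an update (definitional). [folklore] -/
@[simp] theorem PA.addChildR0_I (τ : PA) (j j' : ℕ) (CL : Finset (ℕ × Bool)) (m : ℕ) :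
    (τ.addChildR0 j j' CL m).I = Function.update τ.I j' (some m) := rfl
/-- Reading a field after an update (definitional). [folklore] -/
@[simp] theorem PA.addChildR0_R (τ : PA) (j j' : ℕ) (CL : Finset (ℕ × Bool)) (m : ℕ) :
    (τ.addChildR0 j j' CL m).R = Function.update τ.R (1, j) (some j') := rfl
/-- Reading a field after an update (definitional). [folklore] -/
@[simp] theorem PA.addChildR0_L (τ : PA) (j j' : ℕ) (CL : Finset (ℕ × Bool)) (m : ℕ) :
    (τ.addChildR0 j j' CL m).L = τ.L := rfl
/-- Reading a field after an update (definitional). [folklore] -/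
@[simp] theorem PA.addChildRS_D (τ : PA) (p j j' : ℕ) (CL : Finset (ℕ × Bool)) (ℓ' : ℕ) :
    (τ.addChildRS p j j' CL ℓ').D = Function.update τ.D (p + 1, j') (some CL) := rfl
/-- Reading a field after an update (definitional). [folklore] -/
@[simp] theorem PA.addChildRS_V (τ : PA) (p j j' : ℕ) (CL : Finset (ℕ × Bool)) (ℓ' : ℕ) :
    (τ.addChildRS p j j' CL ℓ').V = Function.update τ.V (p + 1, j') (some ℓ') := rfl
/-- Reading a field after an update (definitional). [folklore] -/
@[simp] theorem PA.addChildRS_I (τ : PA) (p j j' : ℕ) (CL : Finset (ℕ × Bool)) (ℓ' : ℕ) :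
    (τ.addChildRS p j j' CL ℓ').I = τ.I := rfl
/-- Reading a field after an update (definitional). [folklore] -/
@[simp] theorem PA.addChildRS_R (τ : PA) (p j j' : ℕ) (CL : Finset (ℕ × Bool)) (ℓ' : ℕ) :
    (τ.addChildRS p j j' CL ℓ').R = Function.update τ.R (p + 2, j) (some j') := rfl
/-- Reading a field after an update (definitional). [folklore] -/
@[simp] theorem PA.addChildRS_L (τ : PA) (p j j' : ℕ) (CL : Finset (ℕ × Bool)) (ℓ' : ℕ) :
    (τ.addChildRS p j j' CL ℓ').L = τ.L := rfl

/-- Reading an update at another point. [folklore] -/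
theorem update_some_of_ne {α β : Type*} [DecidableEq α] {f : α → Option β} {a a' : α} {b : β}
    {c : β} (h : Function.update f a (some b) a' = some c) (hne : a' ≠ a) : f a' = some c := by
  simpa [Function.update_apply, hne] using h

/-- An update to `some` is nowhere `none` where the old function was not. [folklore] -/
theorem update_ne_none {α β : Type*} [DecidableEq α] {f : α → Option β} {a : α} {b : β}
    (a' : α) (h : f a' ≠ none) : Function.update f a (some b) a' ≠ none := by
  simp only [Function.update_apply]
  split_ifs
  · simp
  · exact h

/-- **Admissibility of the level-`1` extension by an `L`-premise** (Case 3, `i = 2`): the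
child `(0, j')` is fresh, its clause `CL` is full, contains the cut variable positively, is
otherwise contained in `C_{1,j}`, and contains `C_m`.
[cite: Garlik2019, Lemma 19 (proof, Case 3, "τ is an admissible assignment")] -/
theorem Admissible.addChildL0 (hτ : Admissible P Fc τ) (hs : 1 < P.s) {j j' : ℕ} (hj : j < P.t)
    (hj' : j' < P.t) {C CL : Finset (ℕ × Bool)} {ℓ m : ℕ} (hDq : τ.D (1, j) = some C)
    (hVq : τ.V (1, j) = some ℓ) (hDc : τ.D (0, j') = none)
    (hCL : IsFullCl P.n CL) (hcut : (ℓ, true) ∈ CL)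
    (hkeep : ∀ q ∈ CL, q ≠ (ℓ, true) → q ∈ C) (hm : m < P.r) (hFm : Fc m ⊆ CL) :
    Admissible P Fc (τ.addChildL0 j j' CL m) := by
  have ntL : ∀ j₂, τ.L (1, j₂) ≠ some j' := fun j₂ => (hτ.not_target hDc j₂).1
  have ntR : ∀ j₂, τ.R (1, j₂) ≠ some j' := fun j₂ => (hτ.not_target hDc j₂).2
  -- the new values, in the syntactic forms met below
  have nD_par : Function.update τ.D (0, j') (some CL) (0 + 1, j) = some C := by
    rw [Function.update_of_ne (by simp), ← hDq]
  have nD_ch : Function.update τ.D (0, j') (some CL) (0, j') = some CL := by simp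
  have nD_old : ∀ q, q ≠ (0, j') → Function.update τ.D (0, j') (some CL) q = τ.D q :=
    fun q hq => Function.update_of_ne hq _ _
  have grow : ∀ q, τ.D q ≠ none → Function.update τ.D (0, j') (some CL) q ≠ none :=
    fun q hq => update_ne_none q hq
  refine ⟨?_, ?_, ?_, ?_, ?_, ?_, ?_, ?_, ?_, ?_, ?_, ?_, ?_, ?_, ?_, ?_, ?_, ?_, ?_, ?_, ?_⟩
  · -- D_range
    intro i j₂ C' h
    simp only [PA.addChildL0_D, Function.update_apply] at h
    split_ifs at h with hq
    · cases hq; simp only [Option.some.injEq] at h; subst h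
      exact ⟨by omega, hj', hCL.1⟩
    · exact hτ.D_range i j₂ C' h
  · -- V_range
    intro i j₂ k h
    exact hτ.V_range i j₂ k h
  · -- I_range
    intro j₂ k h
    simp only [PA.addChildL0_I, Function.update_apply] at h
    split_ifs at h with hq
    · subst hq; simp only [Option.some.injEq] at h; subst h; exact ⟨hj', hm⟩
    · exact hτ.I_range j₂ k h
  · -- L_range
    intro i j₂ k h
    simp only [PA.addChildL0_L, Function.update_apply] at h
    split_ifs at h with hq
    · cases hq; simp only [Option.some.injEq] at h; subst h
      exact ⟨le_rfl, hs, hj, hj'⟩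
    · exact hτ.L_range i j₂ k h
  · -- R_range
    intro i j₂ k h
    exact hτ.R_range i j₂ k h
  · -- L_D
    intro p j₂ k h
    simp only [PA.addChildL0_L, PA.addChildL0_D] at h ⊢
    by_cases hq : (p + 1, j₂) = (1, j)
    · rw [hq, Function.update_self] at h
      simp only [Option.some.injEq] at h; subst h
      simp only [Prod.mk.injEq] at hq
      obtain ⟨hp0, rfl⟩ := hq
      have hp : p = 0 := by omega
      subst hp
      rw [nD_par, nD_ch]; simp
    · rw [Function.update_of_ne hq] at h
      exact ⟨grow _ (hτ.L_D p j₂ k h).1, grow _ (hτ.L_D p j₂ k h).2⟩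
  · -- R_D
    intro p j₂ k h
    simp only [PA.addChildL0_R, PA.addChildL0_D] at h ⊢
    exact ⟨grow _ (hτ.R_D p j₂ k h).1, grow _ (hτ.R_D p j₂ k h).2⟩
  · -- D_V
    intro p j₂ h
    exact hτ.D_V p j₂ (by simpa [Function.update_apply] using h)
  · -- D_I
    intro j₂ h
    simp only [PA.addChildL0_I, Function.update_apply]
    split_ifs with hq
    · simp
    · exact hτ.D_I j₂ (by simpa [Function.update_apply, hq] using h)
  · -- D_nonTaut
    intro i j₂ C' h
    simp only [PA.addChildL0_D, Function.update_apply] at h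
    split_ifs at h with hq
    · simp only [Option.some.injEq] at h; subst h; exact hCL.2.1
    · exact hτ.D_nonTaut i j₂ C' h
  · -- D_card
    intro i j₂ C' h hlt
    simp only [PA.addChildL0_D, Function.update_apply] at h
    split_ifs at h with hq
    · simp only [Option.some.injEq] at h; subst h
      rw [hCL.card_eq] at hlt; exact absurd hlt (lt_irrefl _)
    · exact hτ.D_card i j₂ C' h hlt
  · -- D_cut
    intro i j₂ C' k h hlt hk
    simp only [PA.addChildL0_D, Function.update_apply] at h
    split_ifs at h with hq
    · simp only [Option.some.injEq] at h; subst h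
      rw [hCL.card_eq] at hlt; exact absurd hlt (lt_irrefl _)
    · exact hτ.D_cut i j₂ C' k h hlt hk
  · -- D_last
    intro i j₂ C' hi hj₂ h
    simp only [PA.addChildL0_D, Function.update_apply] at h
    split_ifs at h with hq
    · cases hq; omega
    · exact hτ.D_last i j₂ C' hi hj₂ h
  · -- D_F
    intro j₂ C' m' h1 h2
    simp only [PA.addChildL0_D, PA.addChildL0_I] at h1 h2
    by_cases hq : j₂ = j'
    · subst hq
      rw [Function.update_self] at h1 h2
      simp only [Option.some.injEq] at h1 h2; subst h1; subst h2; exact hFm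
    · rw [Function.update_of_ne (by simpa using hq)] at h1
      rw [Function.update_of_ne hq] at h2
      exact hτ.D_F j₂ C' m' h1 h2
  · -- L_cut
    intro p j₂ k ℓ₂ C' h1 h2 h3
    simp only [PA.addChildL0_L, PA.addChildL0_V, PA.addChildL0_D] at h1 h2 h3
    by_cases hq : (p + 1, j₂) = (1, j)
    · rw [hq, Function.update_self] at h1
      simp only [Option.some.injEq] at h1; subst h1
      simp only [Prod.mk.injEq] at hq
      obtain ⟨hp0, rfl⟩ := hq
      have hp : p = 0 := by omega
      subst hp
      rw [nD_ch] at h3; simp only [Option.some.injEq] at h3; subst h3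
      rw [hVq] at h2; simp only [Option.some.injEq] at h2; subst h2
      exact hcut
    · rw [Function.update_of_ne hq] at h1
      by_cases hq₃ : (p, k) = (0, j')
      · cases hq₃; exact absurd h1 (ntL j₂)
      · rw [nD_old _ hq₃] at h3
        exact hτ.L_cut p j₂ k ℓ₂ C' h1 h2 h3
  · -- R_cut
    intro p j₂ k ℓ₂ C' h1 h2 h3
    simp only [PA.addChildL0_R, PA.addChildL0_V, PA.addChildL0_D] at h1 h2 h3
    by_cases hq₃ : (p, k) = (0, j')
    · cases hq₃; exact absurd h1 (ntR j₂)
    · rw [nD_old _ hq₃] at h3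
      exact hτ.R_cut p j₂ k ℓ₂ C' h1 h2 h3
  · -- L_keep
    intro p j₂ k ℓ₂ C₀ C' h1 h2 h3 h4
    simp only [PA.addChildL0_L, PA.addChildL0_V, PA.addChildL0_D] at h1 h2 h3 h4
    by_cases hq : (p + 1, j₂) = (1, j)
    · rw [hq, Function.update_self] at h1
      simp only [Option.some.injEq] at h1; subst h1
      simp only [Prod.mk.injEq] at hq
      obtain ⟨hp0, rfl⟩ := hq
      have hp : p = 0 := by omega
      subst hp
      rw [nD_ch] at h4; simp only [Option.some.injEq] at h4; subst h4
      rw [hVq] at h2; simp only [Option.some.injEq] at h2; subst h2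
      rw [nD_par] at h3; simp only [Option.some.injEq] at h3; subst h3
      exact hkeep
    · rw [Function.update_of_ne hq] at h1
      have hq' : (p + 1, j₂) ≠ (0, j') := by simp
      rw [nD_old _ hq'] at h3
      by_cases hq₄ : (p, k) = (0, j')
      · cases hq₄; exact absurd h1 (ntL j₂)
      · rw [nD_old _ hq₄] at h4
        exact hτ.L_keep p j₂ k ℓ₂ C₀ C' h1 h2 h3 h4
  · -- R_keep
    intro p j₂ k ℓ₂ C₀ C' h1 h2 h3 h4
    simp only [PA.addChildL0_R, PA.addChildL0_V, PA.addChildL0_D] at h1 h2 h3 h4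
    have hq' : (p + 1, j₂) ≠ (0, j') := by simp
    rw [nD_old _ hq'] at h3
    by_cases hq₄ : (p, k) = (0, j')
    · cases hq₄; exact absurd h1 (ntR j₂)
    · rw [nD_old _ hq₄] at h4
      exact hτ.R_keep p j₂ k ℓ₂ C₀ C' h1 h2 h3 h4
  · -- inj_LL
    intro i j₁ j₂ k h1 h2
    simp only [PA.addChildL0_L, Function.update_apply] at h1 h2
    split_ifs at h1 h2 with hq₁ hq₂ hq₂
    · cases hq₁; cases hq₂; rfl
    · cases hq₁; simp only [Option.some.injEq] at h1; subst h1; exact absurd h2 (ntL j₂)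
    · cases hq₂; simp only [Option.some.injEq] at h2; subst h2; exact absurd h1 (ntL j₁)
    · exact hτ.inj_LL i j₁ j₂ k h1 h2
  · -- inj_RR
    intro i j₁ j₂ k h1 h2
    exact hτ.inj_RR i j₁ j₂ k h1 h2
  · -- inj_LR
    intro i j₁ j₂ k h1
    simp only [PA.addChildL0_L, PA.addChildL0_R, Function.update_apply] at h1 ⊢
    split_ifs at h1 with hq₁
    · cases hq₁; simp only [Option.some.injEq] at h1; subst h1; exact ntR j₂
    · exact hτ.inj_LR i j₁ j₂ k h1

/-- **Admissibility of the extension by an `L`-premise on a level `p + 2 ≥ 2`** (Case 3,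
`i ≥ 3`): the child `(p+1, j')` is fresh, its clause `CL` is non-tautological, in range, fat
enough, contains the cut variable positively, is otherwise contained in `C_{p+2,j}`, and avoids
the child's cut variable `x_{ℓ'}` unless it is full.
[cite: Garlik2019, Lemma 19 (proof, Case 3, "τ is an admissible assignment")] -/
theorem Admissible.addChildLS (hτ : Admissible P Fc τ) {p j j' : ℕ} (hp : p + 2 < P.s)
    (hj : j < P.t) (hj' : j' < P.t) {C CL : Finset (ℕ × Bool)} {ℓ ℓ' : ℕ}
    (hDq : τ.D (p + 2, j) = some C) (hVq : τ.V (p + 2, j) = some ℓ)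
    (hDc : τ.D (p + 1, j') = none) (hCLr : InRange P.n CL)
    (hCLnt : NonTaut CL) (hcut : (ℓ, true) ∈ CL) (hkeep : ∀ q ∈ CL, q ≠ (ℓ, true) → q ∈ C)
    (hcard : CL.card < P.n → P.s ≤ p + 2 + CL.card) (hℓ' : ℓ' < P.n)
    (hfree : CL.card < P.n → (ℓ', true) ∉ CL ∧ (ℓ', false) ∉ CL) :
    Admissible P Fc (τ.addChildLS p j j' CL ℓ') := by
  have ntL : ∀ j₂, τ.L (p + 2, j₂) ≠ some j' := fun j₂ => (hτ.not_target hDc j₂).1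
  have ntR : ∀ j₂, τ.R (p + 2, j₂) ≠ some j' := fun j₂ => (hτ.not_target hDc j₂).2
  have hcL : τ.L (p + 1, j') = none := (hτ.LR_none hDc).1
  have hcR : τ.R (p + 1, j') = none := (hτ.LR_none hDc).2
  have hpc : (p + 1 + 1, j) ≠ (p + 1, j') := by simp
  have nD_par : Function.update τ.D (p + 1, j') (some CL) (p + 1 + 1, j) = some C := by
    rw [Function.update_of_ne hpc, ← hDq]
  have nD_ch : Function.update τ.D (p + 1, j') (some CL) (p + 1, j') = some CL := by simp
  have nD_old : ∀ q, q ≠ (p + 1, j') → Function.update τ.D (p + 1, j') (some CL) q = τ.D q :=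
    fun q hq => Function.update_of_ne hq _ _
  have nV_par : Function.update τ.V (p + 1, j') (some ℓ') (p + 1 + 1, j) = some ℓ := by
    rw [Function.update_of_ne hpc, ← hVq]
  have nV_old : ∀ q, q ≠ (p + 1, j') → Function.update τ.V (p + 1, j') (some ℓ') q = τ.V q :=
    fun q hq => Function.update_of_ne hq _ _
  have grow : ∀ q, τ.D q ≠ none → Function.update τ.D (p + 1, j') (some CL) q ≠ none :=
    fun q hq => update_ne_none q hq
  have growV : ∀ q, τ.V q ≠ none → Function.update τ.V (p + 1, j') (some ℓ') q ≠ none :=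
    fun q hq => update_ne_none q hq
  refine ⟨?_, ?_, ?_, ?_, ?_, ?_, ?_, ?_, ?_, ?_, ?_, ?_, ?_, ?_, ?_, ?_, ?_, ?_, ?_, ?_, ?_⟩
  · -- D_range
    intro i j₂ C' h
    simp only [PA.addChildLS_D, Function.update_apply] at h
    split_ifs at h with hq
    · cases hq; simp only [Option.some.injEq] at h; subst h
      exact ⟨by omega, hj', hCLr⟩
    · exact hτ.D_range i j₂ C' h
  · -- V_range
    intro i j₂ k h
    simp only [PA.addChildLS_V, Function.update_apply] at h
    split_ifs at h with hq
    · cases hq; simp only [Option.some.injEq] at h; subst h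
      exact ⟨by omega, by omega, hj', hℓ'⟩
    · exact hτ.V_range i j₂ k h
  · -- I_range
    intro j₂ k h
    exact hτ.I_range j₂ k h
  · -- L_range
    intro i j₂ k h
    simp only [PA.addChildLS_L, Function.update_apply] at h
    split_ifs at h with hq
    · cases hq; simp only [Option.some.injEq] at h; subst h
      exact ⟨by omega, hp, hj, hj'⟩
    · exact hτ.L_range i j₂ k h
  · -- R_range
    intro i j₂ k h
    exact hτ.R_range i j₂ k h
  · -- L_D
    intro p₂ j₂ k h
    simp only [PA.addChildLS_L, PA.addChildLS_D] at h ⊢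
    by_cases hq : (p₂ + 1, j₂) = (p + 2, j)
    · rw [hq, Function.update_self] at h
      simp only [Option.some.injEq] at h; subst h
      simp only [Prod.mk.injEq] at hq
      obtain ⟨hp0, rfl⟩ := hq
      have hp' : p₂ = p + 1 := by omega
      subst hp'
      rw [nD_par, nD_ch]; simp
    · rw [Function.update_of_ne hq] at h
      exact ⟨grow _ (hτ.L_D p₂ j₂ k h).1, grow _ (hτ.L_D p₂ j₂ k h).2⟩
  · -- R_D
    intro p₂ j₂ k h
    simp only [PA.addChildLS_R, PA.addChildLS_D] at h ⊢
    exact ⟨grow _ (hτ.R_D p₂ j₂ k h).1, grow _ (hτ.R_D p₂ j₂ k h).2⟩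
  · -- D_V
    intro p₂ j₂ h
    simp only [PA.addChildLS_D, PA.addChildLS_V] at h ⊢
    by_cases hq : (p₂ + 1, j₂) = (p + 1, j')
    · rw [hq]; simp
    · rw [nD_old _ hq] at h
      exact growV _ (hτ.D_V p₂ j₂ h)
  · -- D_I
    intro j₂ h
    exact hτ.D_I j₂ (by simpa [Function.update_apply] using h)
  · -- D_nonTaut
    intro i j₂ C' h
    simp only [PA.addChildLS_D, Function.update_apply] at h
    split_ifs at h with hq
    · simp only [Option.some.injEq] at h; subst h; exact hCLnt
    · exact hτ.D_nonTaut i j₂ C' h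
  · -- D_card
    intro i j₂ C' h hlt
    simp only [PA.addChildLS_D, Function.update_apply] at h
    split_ifs at h with hq
    · cases hq; simp only [Option.some.injEq] at h; subst h
      have := hcard hlt; omega
    · exact hτ.D_card i j₂ C' h hlt
  · -- D_cut
    intro i j₂ C' k h hlt hk
    simp only [PA.addChildLS_D, PA.addChildLS_V] at h hk
    by_cases hq : (i, j₂) = (p + 1, j')
    · rw [hq, Function.update_self] at h hk
      simp only [Option.some.injEq] at h hk; subst h; subst hk; exact hfree hlt
    · rw [nD_old _ hq] at h; rw [nV_old _ hq] at hk
      exact hτ.D_cut i j₂ C' k h hlt hk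
  · -- D_last
    intro i j₂ C' hi hj₂ h
    simp only [PA.addChildLS_D, Function.update_apply] at h
    split_ifs at h with hq
    · cases hq; omega
    · exact hτ.D_last i j₂ C' hi hj₂ h
  · -- D_F
    intro j₂ C' m' h1 h2
    exact hτ.D_F j₂ C' m' (by simpa [Function.update_apply] using h1) h2
  · -- L_cut
    intro p₂ j₂ k ℓ₂ C' h1 h2 h3
    simp only [PA.addChildLS_L, PA.addChildLS_V, PA.addChildLS_D] at h1 h2 h3
    by_cases hq : (p₂ + 1, j₂) = (p + 2, j)
    · rw [hq, Function.update_self] at h1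
      simp only [Option.some.injEq] at h1; subst h1
      simp only [Prod.mk.injEq] at hq
      obtain ⟨hp0, rfl⟩ := hq
      have hp' : p₂ = p + 1 := by omega
      subst hp'
      rw [nD_ch] at h3; simp only [Option.some.injEq] at h3; subst h3
      rw [nV_par] at h2; simp only [Option.some.injEq] at h2; subst h2
      exact hcut
    · rw [Function.update_of_ne hq] at h1
      by_cases hq₂ : (p₂ + 1, j₂) = (p + 1, j')
      · cases hq₂; rw [hcL] at h1; exact absurd h1 (by simp)
      · rw [nV_old _ hq₂] at h2
        by_cases hq₃ : (p₂, k) = (p + 1, j')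
        · cases hq₃; exact absurd h1 (ntL j₂)
        · rw [nD_old _ hq₃] at h3
          exact hτ.L_cut p₂ j₂ k ℓ₂ C' h1 h2 h3
  · -- R_cut
    intro p₂ j₂ k ℓ₂ C' h1 h2 h3
    simp only [PA.addChildLS_R, PA.addChildLS_V, PA.addChildLS_D] at h1 h2 h3
    by_cases hq₂ : (p₂ + 1, j₂) = (p + 1, j')
    · cases hq₂; rw [hcR] at h1; exact absurd h1 (by simp)
    · rw [nV_old _ hq₂] at h2
      by_cases hq₃ : (p₂, k) = (p + 1, j')
      · cases hq₃; exact absurd h1 (ntR j₂)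
      · rw [nD_old _ hq₃] at h3
        exact hτ.R_cut p₂ j₂ k ℓ₂ C' h1 h2 h3
  · -- L_keep
    intro p₂ j₂ k ℓ₂ C₀ C' h1 h2 h3 h4
    simp only [PA.addChildLS_L, PA.addChildLS_V, PA.addChildLS_D] at h1 h2 h3 h4
    by_cases hq : (p₂ + 1, j₂) = (p + 2, j)
    · rw [hq, Function.update_self] at h1
      simp only [Option.some.injEq] at h1; subst h1
      simp only [Prod.mk.injEq] at hq
      obtain ⟨hp0, rfl⟩ := hq
      have hp' : p₂ = p + 1 := by omega
      subst hp'
      rw [nD_ch] at h4; simp only [Option.some.injEq] at h4; subst h4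
      rw [nV_par] at h2; simp only [Option.some.injEq] at h2; subst h2
      rw [nD_par] at h3; simp only [Option.some.injEq] at h3; subst h3
      exact hkeep
    · rw [Function.update_of_ne hq] at h1
      by_cases hq₂ : (p₂ + 1, j₂) = (p + 1, j')
      · cases hq₂; rw [hcL] at h1; exact absurd h1 (by simp)
      · rw [nV_old _ hq₂] at h2; rw [nD_old _ hq₂] at h3
        by_cases hq₄ : (p₂, k) = (p + 1, j')
        · cases hq₄; exact absurd h1 (ntL j₂)
        · rw [nD_old _ hq₄] at h4
          exact hτ.L_keep p₂ j₂ k ℓ₂ C₀ C' h1 h2 h3 h4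
  · -- R_keep
    intro p₂ j₂ k ℓ₂ C₀ C' h1 h2 h3 h4
    simp only [PA.addChildLS_R, PA.addChildLS_V, PA.addChildLS_D] at h1 h2 h3 h4
    by_cases hq₂ : (p₂ + 1, j₂) = (p + 1, j')
    · cases hq₂; rw [hcR] at h1; exact absurd h1 (by simp)
    · rw [nV_old _ hq₂] at h2; rw [nD_old _ hq₂] at h3
      by_cases hq₄ : (p₂, k) = (p + 1, j')
      · cases hq₄; exact absurd h1 (ntR j₂)
      · rw [nD_old _ hq₄] at h4
        exact hτ.R_keep p₂ j₂ k ℓ₂ C₀ C' h1 h2 h3 h4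
  · -- inj_LL
    intro i j₁ j₂ k h1 h2
    simp only [PA.addChildLS_L, Function.update_apply] at h1 h2
    split_ifs at h1 h2 with hq₁ hq₂ hq₂
    · cases hq₁; cases hq₂; rfl
    · cases hq₁; simp only [Option.some.injEq] at h1; subst h1; exact absurd h2 (ntL j₂)
    · cases hq₂; simp only [Option.some.injEq] at h2; subst h2; exact absurd h1 (ntL j₁)
    · exact hτ.inj_LL i j₁ j₂ k h1 h2
  · -- inj_RR
    intro i j₁ j₂ k h1 h2
    exact hτ.inj_RR i j₁ j₂ k h1 h2
  · -- inj_LR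
    intro i j₁ j₂ k h1
    simp only [PA.addChildLS_L, PA.addChildLS_R, Function.update_apply] at h1 ⊢
    split_ifs at h1 with hq₁
    · cases hq₁; simp only [Option.some.injEq] at h1; subst h1; exact ntR j₂
    · exact hτ.inj_LR i j₁ j₂ k h1

/-- **Admissibility of the level-`1` extension by an `R`-premise** (Case 3, `i = 2`): the
child `(0, j')` is fresh, its clause `CL` is full, contains the cut variable negatively, is
otherwise contained in `C_{1,j}`, and contains `C_m`.
[cite: Garlik2019, Lemma 19 (proof, Case 3, "τ is an admissible assignment")] -/
theorem Admissible.addChildR0 (hτ : Admissible P Fc τ) (hs : 1 < P.s) {j j' : ℕ} (hj : j < P.t)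
    (hj' : j' < P.t) {C CL : Finset (ℕ × Bool)} {ℓ m : ℕ} (hDq : τ.D (1, j) = some C)
    (hVq : τ.V (1, j) = some ℓ) (hDc : τ.D (0, j') = none)
    (hCL : IsFullCl P.n CL) (hcut : (ℓ, false) ∈ CL)
    (hkeep : ∀ q ∈ CL, q ≠ (ℓ, false) → q ∈ C) (hm : m < P.r) (hFm : Fc m ⊆ CL) :
    Admissible P Fc (τ.addChildR0 j j' CL m) := by
  have ntR : ∀ j₂, τ.R (1, j₂) ≠ some j' := fun j₂ => (hτ.not_target hDc j₂).2
  have ntL : ∀ j₂, τ.L (1, j₂) ≠ some j' := fun j₂ => (hτ.not_target hDc j₂).1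
  -- the new values, in the syntactic forms met below
  have nD_par : Function.update τ.D (0, j') (some CL) (0 + 1, j) = some C := by
    rw [Function.update_of_ne (by simp), ← hDq]
  have nD_ch : Function.update τ.D (0, j') (some CL) (0, j') = some CL := by simp
  have nD_old : ∀ q, q ≠ (0, j') → Function.update τ.D (0, j') (some CL) q = τ.D q :=
    fun q hq => Function.update_of_ne hq _ _
  have grow : ∀ q, τ.D q ≠ none → Function.update τ.D (0, j') (some CL) q ≠ none :=
    fun q hq => update_ne_none q hq
  refine ⟨?_, ?_, ?_, ?_, ?_, ?_, ?_, ?_, ?_, ?_, ?_, ?_, ?_, ?_, ?_, ?_, ?_, ?_, ?_, ?_, ?_⟩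
  · -- D_range
    intro i j₂ C' h
    simp only [PA.addChildR0_D, Function.update_apply] at h
    split_ifs at h with hq
    · cases hq; simp only [Option.some.injEq] at h; subst h
      exact ⟨by omega, hj', hCL.1⟩
    · exact hτ.D_range i j₂ C' h
  · -- V_range
    intro i j₂ k h
    exact hτ.V_range i j₂ k h
  · -- I_range
    intro j₂ k h
    simp only [PA.addChildR0_I, Function.update_apply] at h
    split_ifs at h with hq
    · subst hq; simp only [Option.some.injEq] at h; subst h; exact ⟨hj', hm⟩
    · exact hτ.I_range j₂ k h
  · -- L_range
    intro i j₂ k h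
    exact hτ.L_range i j₂ k h
  · -- R_range
    intro i j₂ k h
    simp only [PA.addChildR0_R, Function.update_apply] at h
    split_ifs at h with hq
    · cases hq; simp only [Option.some.injEq] at h; subst h
      exact ⟨le_rfl, hs, hj, hj'⟩
    · exact hτ.R_range i j₂ k h
  · -- L_D
    intro p j₂ k h
    simp only [PA.addChildR0_L, PA.addChildR0_D] at h ⊢
    exact ⟨grow _ (hτ.L_D p j₂ k h).1, grow _ (hτ.L_D p j₂ k h).2⟩
  · -- R_D
    intro p j₂ k h
    simp only [PA.addChildR0_R, PA.addChildR0_D] at h ⊢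
    by_cases hq : (p + 1, j₂) = (1, j)
    · rw [hq, Function.update_self] at h
      simp only [Option.some.injEq] at h; subst h
      simp only [Prod.mk.injEq] at hq
      obtain ⟨hp0, rfl⟩ := hq
      have hp : p = 0 := by omega
      subst hp
      rw [nD_par, nD_ch]; simp
    · rw [Function.update_of_ne hq] at h
      exact ⟨grow _ (hτ.R_D p j₂ k h).1, grow _ (hτ.R_D p j₂ k h).2⟩
  · -- D_V
    intro p j₂ h
    exact hτ.D_V p j₂ (by simpa [Function.update_apply] using h)
  · -- D_I
    intro j₂ h
    simp only [PA.addChildR0_I, Function.update_apply]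
    split_ifs with hq
    · simp
    · exact hτ.D_I j₂ (by simpa [Function.update_apply, hq] using h)
  · -- D_nonTaut
    intro i j₂ C' h
    simp only [PA.addChildR0_D, Function.update_apply] at h
    split_ifs at h with hq
    · simp only [Option.some.injEq] at h; subst h; exact hCL.2.1
    · exact hτ.D_nonTaut i j₂ C' h
  · -- D_card
    intro i j₂ C' h hlt
    simp only [PA.addChildR0_D, Function.update_apply] at h
    split_ifs at h with hq
    · simp only [Option.some.injEq] at h; subst h
      rw [hCL.card_eq] at hlt; exact absurd hlt (lt_irrefl _)
    · exact hτ.D_card i j₂ C' h hlt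
  · -- D_cut
    intro i j₂ C' k h hlt hk
    simp only [PA.addChildR0_D, Function.update_apply] at h
    split_ifs at h with hq
    · simp only [Option.some.injEq] at h; subst h
      rw [hCL.card_eq] at hlt; exact absurd hlt (lt_irrefl _)
    · exact hτ.D_cut i j₂ C' k h hlt hk
  · -- D_last
    intro i j₂ C' hi hj₂ h
    simp only [PA.addChildR0_D, Function.update_apply] at h
    split_ifs at h with hq
    · cases hq; omega
    · exact hτ.D_last i j₂ C' hi hj₂ h
  · -- D_F
    intro j₂ C' m' h1 h2
    simp only [PA.addChildR0_D, PA.addChildR0_I] at h1 h2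
    by_cases hq : j₂ = j'
    · subst hq
      rw [Function.update_self] at h1 h2
      simp only [Option.some.injEq] at h1 h2; subst h1; subst h2; exact hFm
    · rw [Function.update_of_ne (by simpa using hq)] at h1
      rw [Function.update_of_ne hq] at h2
      exact hτ.D_F j₂ C' m' h1 h2
  · -- L_cut
    intro p j₂ k ℓ₂ C' h1 h2 h3
    simp only [PA.addChildR0_L, PA.addChildR0_V, PA.addChildR0_D] at h1 h2 h3
    by_cases hq₃ : (p, k) = (0, j')
    · cases hq₃; exact absurd h1 (ntL j₂)
    · rw [nD_old _ hq₃] at h3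
      exact hτ.L_cut p j₂ k ℓ₂ C' h1 h2 h3
  · -- R_cut
    intro p j₂ k ℓ₂ C' h1 h2 h3
    simp only [PA.addChildR0_R, PA.addChildR0_V, PA.addChildR0_D] at h1 h2 h3
    by_cases hq : (p + 1, j₂) = (1, j)
    · rw [hq, Function.update_self] at h1
      simp only [Option.some.injEq] at h1; subst h1
      simp only [Prod.mk.injEq] at hq
      obtain ⟨hp0, rfl⟩ := hq
      have hp : p = 0 := by omega
      subst hp
      rw [nD_ch] at h3; simp only [Option.some.injEq] at h3; subst h3
      rw [hVq] at h2; simp only [Option.some.injEq] at h2; subst h2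
      exact hcut
    · rw [Function.update_of_ne hq] at h1
      by_cases hq₃ : (p, k) = (0, j')
      · cases hq₃; exact absurd h1 (ntR j₂)
      · rw [nD_old _ hq₃] at h3
        exact hτ.R_cut p j₂ k ℓ₂ C' h1 h2 h3
  · -- L_keep
    intro p j₂ k ℓ₂ C₀ C' h1 h2 h3 h4
    simp only [PA.addChildR0_L, PA.addChildR0_V, PA.addChildR0_D] at h1 h2 h3 h4
    have hq' : (p + 1, j₂) ≠ (0, j') := by simp
    rw [nD_old _ hq'] at h3
    by_cases hq₄ : (p, k) = (0, j')
    · cases hq₄; exact absurd h1 (ntL j₂)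
    · rw [nD_old _ hq₄] at h4
      exact hτ.L_keep p j₂ k ℓ₂ C₀ C' h1 h2 h3 h4
  · -- R_keep
    intro p j₂ k ℓ₂ C₀ C' h1 h2 h3 h4
    simp only [PA.addChildR0_R, PA.addChildR0_V, PA.addChildR0_D] at h1 h2 h3 h4
    by_cases hq : (p + 1, j₂) = (1, j)
    · rw [hq, Function.update_self] at h1
      simp only [Option.some.injEq] at h1; subst h1
      simp only [Prod.mk.injEq] at hq
      obtain ⟨hp0, rfl⟩ := hq
      have hp : p = 0 := by omega
      subst hp
      rw [nD_ch] at h4; simp only [Option.some.injEq] at h4; subst h4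
      rw [hVq] at h2; simp only [Option.some.injEq] at h2; subst h2
      rw [nD_par] at h3; simp only [Option.some.injEq] at h3; subst h3
      exact hkeep
    · rw [Function.update_of_ne hq] at h1
      have hq' : (p + 1, j₂) ≠ (0, j') := by simp
      rw [nD_old _ hq'] at h3
      by_cases hq₄ : (p, k) = (0, j')
      · cases hq₄; exact absurd h1 (ntR j₂)
      · rw [nD_old _ hq₄] at h4
        exact hτ.R_keep p j₂ k ℓ₂ C₀ C' h1 h2 h3 h4
  · -- inj_LL
    intro i j₁ j₂ k h1 h2
    exact hτ.inj_LL i j₁ j₂ k h1 h2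
  · -- inj_RR
    intro i j₁ j₂ k h1 h2
    simp only [PA.addChildR0_R, Function.update_apply] at h1 h2
    split_ifs at h1 h2 with hq₁ hq₂ hq₂
    · cases hq₁; cases hq₂; rfl
    · cases hq₁; simp only [Option.some.injEq] at h1; subst h1; exact absurd h2 (ntR j₂)
    · cases hq₂; simp only [Option.some.injEq] at h2; subst h2; exact absurd h1 (ntR j₁)
    · exact hτ.inj_RR i j₁ j₂ k h1 h2
  · -- inj_LR
    intro i j₁ j₂ k h1
    simp only [PA.addChildR0_R, PA.addChildR0_L, Function.update_apply] at h1 ⊢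
    split_ifs with hq₂
    · cases hq₂
      simp only [ne_eq, Option.some.injEq]
      rintro rfl
      exact ntL j₁ h1
    · exact hτ.inj_LR i j₁ j₂ k h1

/-- **Admissibility of the extension by an `R`-premise on a level `p + 2 ≥ 2`** (Case 3,
`i ≥ 3`): the child `(p+1, j')` is fresh, its clause `CL` is non-tautological, in range, fat
enough, contains the cut variable negatively, is otherwise contained in `C_{p+2,j}`, and avoids
the child's cut variable `x_{ℓ'}` unless it is full.
[cite: Garlik2019, Lemma 19 (proof, Case 3, "τ is an admissible assignment")] -/
theorem Admissible.addChildRS (hτ : Admissible P Fc τ) {p j j' : ℕ} (hp : p + 2 < P.s)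
    (hj : j < P.t) (hj' : j' < P.t) {C CL : Finset (ℕ × Bool)} {ℓ ℓ' : ℕ}
    (hDq : τ.D (p + 2, j) = some C) (hVq : τ.V (p + 2, j) = some ℓ)
    (hDc : τ.D (p + 1, j') = none) (hCLr : InRange P.n CL)
    (hCLnt : NonTaut CL) (hcut : (ℓ, false) ∈ CL) (hkeep : ∀ q ∈ CL, q ≠ (ℓ, false) → q ∈ C)
    (hcard : CL.card < P.n → P.s ≤ p + 2 + CL.card) (hℓ' : ℓ' < P.n)
    (hfree : CL.card < P.n → (ℓ', true) ∉ CL ∧ (ℓ', false) ∉ CL) :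
    Admissible P Fc (τ.addChildRS p j j' CL ℓ') := by
  have ntR : ∀ j₂, τ.R (p + 2, j₂) ≠ some j' := fun j₂ => (hτ.not_target hDc j₂).2
  have ntL : ∀ j₂, τ.L (p + 2, j₂) ≠ some j' := fun j₂ => (hτ.not_target hDc j₂).1
  have hcR : τ.R (p + 1, j') = none := (hτ.LR_none hDc).2
  have hcL : τ.L (p + 1, j') = none := (hτ.LR_none hDc).1
  have hpc : (p + 1 + 1, j) ≠ (p + 1, j') := by simp
  have nD_par : Function.update τ.D (p + 1, j') (some CL) (p + 1 + 1, j) = some C := by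
    rw [Function.update_of_ne hpc, ← hDq]
  have nD_ch : Function.update τ.D (p + 1, j') (some CL) (p + 1, j') = some CL := by simp
  have nD_old : ∀ q, q ≠ (p + 1, j') → Function.update τ.D (p + 1, j') (some CL) q = τ.D q :=
    fun q hq => Function.update_of_ne hq _ _
  have nV_par : Function.update τ.V (p + 1, j') (some ℓ') (p + 1 + 1, j) = some ℓ := by
    rw [Function.update_of_ne hpc, ← hVq]
  have nV_old : ∀ q, q ≠ (p + 1, j') → Function.update τ.V (p + 1, j') (some ℓ') q = τ.V q :=
    fun q hq => Function.update_of_ne hq _ _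
  have grow : ∀ q, τ.D q ≠ none → Function.update τ.D (p + 1, j') (some CL) q ≠ none :=
    fun q hq => update_ne_none q hq
  have growV : ∀ q, τ.V q ≠ none → Function.update τ.V (p + 1, j') (some ℓ') q ≠ none :=
    fun q hq => update_ne_none q hq
  refine ⟨?_, ?_, ?_, ?_, ?_, ?_, ?_, ?_, ?_, ?_, ?_, ?_, ?_, ?_, ?_, ?_, ?_, ?_, ?_, ?_, ?_⟩
  · -- D_range
    intro i j₂ C' h
    simp only [PA.addChildRS_D, Function.update_apply] at h
    split_ifs at h with hq
    · cases hq; simp only [Option.some.injEq] at h; subst h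
      exact ⟨by omega, hj', hCLr⟩
    · exact hτ.D_range i j₂ C' h
  · -- V_range
    intro i j₂ k h
    simp only [PA.addChildRS_V, Function.update_apply] at h
    split_ifs at h with hq
    · cases hq; simp only [Option.some.injEq] at h; subst h
      exact ⟨by omega, by omega, hj', hℓ'⟩
    · exact hτ.V_range i j₂ k h
  · -- I_range
    intro j₂ k h
    exact hτ.I_range j₂ k h
  · -- L_range
    intro i j₂ k h
    exact hτ.L_range i j₂ k h
  · -- R_range
    intro i j₂ k h
    simp only [PA.addChildRS_R, Function.update_apply] at h
    split_ifs at h with hq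
    · cases hq; simp only [Option.some.injEq] at h; subst h
      exact ⟨by omega, hp, hj, hj'⟩
    · exact hτ.R_range i j₂ k h
  · -- L_D
    intro p₂ j₂ k h
    simp only [PA.addChildRS_L, PA.addChildRS_D] at h ⊢
    exact ⟨grow _ (hτ.L_D p₂ j₂ k h).1, grow _ (hτ.L_D p₂ j₂ k h).2⟩
  · -- R_D
    intro p₂ j₂ k h
    simp only [PA.addChildRS_R, PA.addChildRS_D] at h ⊢
    by_cases hq : (p₂ + 1, j₂) = (p + 2, j)
    · rw [hq, Function.update_self] at h
      simp only [Option.some.injEq] at h; subst h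
      simp only [Prod.mk.injEq] at hq
      obtain ⟨hp0, rfl⟩ := hq
      have hp' : p₂ = p + 1 := by omega
      subst hp'
      rw [nD_par, nD_ch]; simp
    · rw [Function.update_of_ne hq] at h
      exact ⟨grow _ (hτ.R_D p₂ j₂ k h).1, grow _ (hτ.R_D p₂ j₂ k h).2⟩
  · -- D_V
    intro p₂ j₂ h
    simp only [PA.addChildRS_D, PA.addChildRS_V] at h ⊢
    by_cases hq : (p₂ + 1, j₂) = (p + 1, j')
    · rw [hq]; simp
    · rw [nD_old _ hq] at h
      exact growV _ (hτ.D_V p₂ j₂ h)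
  · -- D_I
    intro j₂ h
    exact hτ.D_I j₂ (by simpa [Function.update_apply] using h)
  · -- D_nonTaut
    intro i j₂ C' h
    simp only [PA.addChildRS_D, Function.update_apply] at h
    split_ifs at h with hq
    · simp only [Option.some.injEq] at h; subst h; exact hCLnt
    · exact hτ.D_nonTaut i j₂ C' h
  · -- D_card
    intro i j₂ C' h hlt
    simp only [PA.addChildRS_D, Function.update_apply] at h
    split_ifs at h with hq
    · cases hq; simp only [Option.some.injEq] at h; subst h
      have := hcard hlt; omega
    · exact hτ.D_card i j₂ C' h hlt
  · -- D_cut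
    intro i j₂ C' k h hlt hk
    simp only [PA.addChildRS_D, PA.addChildRS_V] at h hk
    by_cases hq : (i, j₂) = (p + 1, j')
    · rw [hq, Function.update_self] at h hk
      simp only [Option.some.injEq] at h hk; subst h; subst hk; exact hfree hlt
    · rw [nD_old _ hq] at h; rw [nV_old _ hq] at hk
      exact hτ.D_cut i j₂ C' k h hlt hk
  · -- D_last
    intro i j₂ C' hi hj₂ h
    simp only [PA.addChildRS_D, Function.update_apply] at h
    split_ifs at h with hq
    · cases hq; omega
    · exact hτ.D_last i j₂ C' hi hj₂ h
  · -- D_F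
    intro j₂ C' m' h1 h2
    exact hτ.D_F j₂ C' m' (by simpa [Function.update_apply] using h1) h2
  · -- L_cut
    intro p₂ j₂ k ℓ₂ C' h1 h2 h3
    simp only [PA.addChildRS_L, PA.addChildRS_V, PA.addChildRS_D] at h1 h2 h3
    by_cases hq₂ : (p₂ + 1, j₂) = (p + 1, j')
    · cases hq₂; rw [hcL] at h1; exact absurd h1 (by simp)
    · rw [nV_old _ hq₂] at h2
      by_cases hq₃ : (p₂, k) = (p + 1, j')
      · cases hq₃; exact absurd h1 (ntL j₂)
      · rw [nD_old _ hq₃] at h3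
        exact hτ.L_cut p₂ j₂ k ℓ₂ C' h1 h2 h3
  · -- R_cut
    intro p₂ j₂ k ℓ₂ C' h1 h2 h3
    simp only [PA.addChildRS_R, PA.addChildRS_V, PA.addChildRS_D] at h1 h2 h3
    by_cases hq : (p₂ + 1, j₂) = (p + 2, j)
    · rw [hq, Function.update_self] at h1
      simp only [Option.some.injEq] at h1; subst h1
      simp only [Prod.mk.injEq] at hq
      obtain ⟨hp0, rfl⟩ := hq
      have hp' : p₂ = p + 1 := by omega
      subst hp'
      rw [nD_ch] at h3; simp only [Option.some.injEq] at h3; subst h3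
      rw [nV_par] at h2; simp only [Option.some.injEq] at h2; subst h2
      exact hcut
    · rw [Function.update_of_ne hq] at h1
      by_cases hq₂ : (p₂ + 1, j₂) = (p + 1, j')
      · cases hq₂; rw [hcR] at h1; exact absurd h1 (by simp)
      · rw [nV_old _ hq₂] at h2
        by_cases hq₃ : (p₂, k) = (p + 1, j')
        · cases hq₃; exact absurd h1 (ntR j₂)
        · rw [nD_old _ hq₃] at h3
          exact hτ.R_cut p₂ j₂ k ℓ₂ C' h1 h2 h3
  · -- L_keep
    intro p₂ j₂ k ℓ₂ C₀ C' h1 h2 h3 h4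
    simp only [PA.addChildRS_L, PA.addChildRS_V, PA.addChildRS_D] at h1 h2 h3 h4
    by_cases hq₂ : (p₂ + 1, j₂) = (p + 1, j')
    · cases hq₂; rw [hcL] at h1; exact absurd h1 (by simp)
    · rw [nV_old _ hq₂] at h2; rw [nD_old _ hq₂] at h3
      by_cases hq₄ : (p₂, k) = (p + 1, j')
      · cases hq₄; exact absurd h1 (ntL j₂)
      · rw [nD_old _ hq₄] at h4
        exact hτ.L_keep p₂ j₂ k ℓ₂ C₀ C' h1 h2 h3 h4
  · -- R_keep
    intro p₂ j₂ k ℓ₂ C₀ C' h1 h2 h3 h4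
    simp only [PA.addChildRS_R, PA.addChildRS_V, PA.addChildRS_D] at h1 h2 h3 h4
    by_cases hq : (p₂ + 1, j₂) = (p + 2, j)
    · rw [hq, Function.update_self] at h1
      simp only [Option.some.injEq] at h1; subst h1
      simp only [Prod.mk.injEq] at hq
      obtain ⟨hp0, rfl⟩ := hq
      have hp' : p₂ = p + 1 := by omega
      subst hp'
      rw [nD_ch] at h4; simp only [Option.some.injEq] at h4; subst h4
      rw [nV_par] at h2; simp only [Option.some.injEq] at h2; subst h2
      rw [nD_par] at h3; simp only [Option.some.injEq] at h3; subst h3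
      exact hkeep
    · rw [Function.update_of_ne hq] at h1
      by_cases hq₂ : (p₂ + 1, j₂) = (p + 1, j')
      · cases hq₂; rw [hcR] at h1; exact absurd h1 (by simp)
      · rw [nV_old _ hq₂] at h2; rw [nD_old _ hq₂] at h3
        by_cases hq₄ : (p₂, k) = (p + 1, j')
        · cases hq₄; exact absurd h1 (ntR j₂)
        · rw [nD_old _ hq₄] at h4
          exact hτ.R_keep p₂ j₂ k ℓ₂ C₀ C' h1 h2 h3 h4
  · -- inj_LL
    intro i j₁ j₂ k h1 h2
    exact hτ.inj_LL i j₁ j₂ k h1 h2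
  · -- inj_RR
    intro i j₁ j₂ k h1 h2
    simp only [PA.addChildRS_R, Function.update_apply] at h1 h2
    split_ifs at h1 h2 with hq₁ hq₂ hq₂
    · cases hq₁; cases hq₂; rfl
    · cases hq₁; simp only [Option.some.injEq] at h1; subst h1; exact absurd h2 (ntR j₂)
    · cases hq₂; simp only [Option.some.injEq] at h2; subst h2; exact absurd h1 (ntR j₁)
    · exact hτ.inj_RR i j₁ j₂ k h1 h2
  · -- inj_LR
    intro i j₁ j₂ k h1
    simp only [PA.addChildRS_R, PA.addChildRS_L, Function.update_apply] at h1 ⊢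
    split_ifs with hq₂
    · cases hq₂
      simp only [ne_eq, Option.some.injEq]
      rintro rfl
      exact ntL j₁ h1
    · exact hτ.inj_LR i j₁ j₂ k h1

end AddChild

/-! ### Case 3: existence of the extension by a premise -/

section SetPrem

variable {P : Params} {Fc : ℕ → Finset (ℕ × Bool)} {E : Finset (Literal ℕ)} {σ : PA}
  {K W T : ℕ}

/-- A position outside `setPairs` has all its groups unset. [folklore] -/
theorem not_mem_setPairs {τ : PA} {i j' : ℕ} (h : j' ∉ setPairs P τ i) (hj' : j' < P.t) :
    τ.D (i, j') = none ∧ τ.V (i, j') = none ∧ τ.L (i, j') = none ∧ τ.R (i, j') = none ∧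
      (i = 0 → τ.I j' = none) := by
  classical
  simp only [setPairs, Finset.mem_filter, Finset.mem_range, not_and, not_or, not_not] at h
  obtain ⟨h1, h2, h3, h4, h5⟩ := h hj'
  exact ⟨h1, h2, h3, h4, fun hi => by simpa [hi] using h5⟩

/-- **The counting step of Case 3**: the three avoidance sets leave a position free, since
`|U_1| ≤ 3K + 7W`, `|U_2| < t/2`, `|U_3| ≤ T` and `2(3K + 7W + T) + 1 ≤ t`.
[cite: Garlik2019, Lemma 19 (proof, Case 3: "|U_1 ∪ U_2 ∪ U_3| ≤ 10pt+4w+t/2+t/4 < t")] -/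
theorem exists_avoid (U₁ U₂ U₃ : Finset ℕ) {A t : ℕ} (h1 : U₁.card ≤ A) (h2 : 2 * U₂.card < t)
    (h3 : U₃.card ≤ T) (hnum : 2 * (A + T) + 1 ≤ t) :
    ∃ j' < t, j' ∉ U₁ ∧ j' ∉ U₂ ∧ j' ∉ U₃ := by
  classical
  have hlt : (U₁ ∪ U₂ ∪ U₃).card < (Finset.range t).card := by
    rw [Finset.card_range]
    calc (U₁ ∪ U₂ ∪ U₃).card ≤ (U₁ ∪ U₂).card + U₃.card := Finset.card_union_le _ _
      _ ≤ U₁.card + U₂.card + U₃.card := by gcongr; exact Finset.card_union_le _ _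
      _ < t := by omega
  obtain ⟨j', hj', hnot⟩ := Finset.exists_mem_notMem_of_card_lt_card hlt
  simp only [Finset.mem_union, not_or] at hnot
  exact ⟨j', Finset.mem_range.1 hj', hnot.1.1, hnot.1.2, hnot.2⟩

/-- The common first half of Case 3: make sure the clause (and cut variable) of the pair is
set, keeping the premise unset and the other levels untouched. [cite: Garlik2019, Lemma 19
(proof, Case 3: "if not, perform the steps in Case 2 to set them both")] -/
theorem exists_parent (hP : CoreHyp P Fc) (hσ : Admissible P Fc σ) (hF : Falsi P σ E)
    (hC : Covered P σ E) {p j : ℕ} (hp : p + 1 < P.s) (hj : j < P.t) :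
    ∃ τ : PA, Admissible P Fc τ ∧ Ext σ τ ∧ Falsi P τ E ∧ Covered P τ E ∧
      (∃ C ℓ, τ.D (p + 1, j) = some C ∧ τ.V (p + 1, j) = some ℓ) ∧
      τ.L (p + 1, j) = σ.L (p + 1, j) ∧ τ.R (p + 1, j) = σ.R (p + 1, j) ∧
      setPairs P τ p = setPairs P σ p := by
  cases hD : σ.D (p + 1, j) with
  | some C =>
    obtain ⟨ℓ, hℓ⟩ := Option.ne_none_iff_exists'.1 (hσ.D_V p j (by rw [hD]; simp))
    exact ⟨σ, hσ, Ext.refl σ, hF, hC, ⟨C, ℓ, hD, hℓ⟩, rfl, rfl, rfl⟩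
  | none =>
    obtain ⟨τ, hτ, hE, hFτ, hDτ, ⟨hL, hR⟩, hsame⟩ := exists_fillD hP hσ hF hC hp hj hD
    obtain ⟨C, hCτ⟩ := Option.ne_none_iff_exists'.1 hDτ
    obtain ⟨ℓ, hℓ⟩ := Option.ne_none_iff_exists'.1 (hτ.D_V p j hDτ)
    exact ⟨τ, hτ, hE, hFτ, hC.ext hE, ⟨C, ℓ, hCτ, hℓ⟩, by rw [hL], by rw [hR],
      hsame p (by omega)⟩

/-- **[Garlík 2019, Lemma 19, Case 3] for `L`.** If `L(p+1,j,·)` is unset in an admissible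
assignment `σ` falsifying `E` where defined and covering `E`, which sets groups at at most
`3K + 7W` pairs per level, while `E` is `(W,T)`-narrow and `2(3K + 7W + T) + 1 ≤ t`, then `σ`
extends to an admissible assignment setting `L(p+1,j,·)` and still falsifying `E` where
defined. [cite: Garlik2019, Lemma 19 (proof, Case 3)] -/
theorem exists_setL (hP : CoreHyp P Fc) (hσ : Admissible P Fc σ) (hF : Falsi P σ E)
    (hC : Covered P σ E) (hU : ∀ i, (setPairs P σ i).card ≤ 3 * K + 7 * W)
    (hN : Narrow P W T E) (hnum : 2 * (3 * K + 7 * W + T) + 1 ≤ P.t) {p j : ℕ}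
    (hp : p + 1 < P.s) (hj : j < P.t) (hL : σ.L (p + 1, j) = none) :
    ∃ τ : PA, Admissible P Fc τ ∧ Ext σ τ ∧ Falsi P τ E ∧ τ.L (p + 1, j) ≠ none := by
  classical
  -- the pair is not `L`-important: no negative and fewer than `t/2` positive `L`-literals
  have hnL : ¬ LImp P E (p + 1) j := hC.not_LImp hL
  simp only [LImp, not_and, not_or, not_le] at hnL
  obtain ⟨hneg, hpos⟩ := hnL (by omega) hp hj
  -- Step 1: the parent clause and cut variable
  obtain ⟨τ₂, hτ₂, hE₂, hF₂, hC₂, ⟨C, ℓ, hDq, hVq⟩, hL₂, -, hsp⟩ :=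
    exists_parent hP hσ hF hC hp hj
  rw [hL] at hL₂
  have hCr : InRange P.n C := (hτ₂.D_range _ _ _ hDq).2.2
  have hCnt : NonTaut C := hτ₂.D_nonTaut _ _ _ hDq
  have hℓ : ℓ < P.n := (hτ₂.V_range _ _ _ hVq).2.2.2
  have hCcard : C.card < P.n → P.s ≤ p + 1 + 1 + C.card := hτ₂.D_card _ _ _ hDq
  have hCcut : C.card < P.n → (ℓ, true) ∉ C ∧ (ℓ, false) ∉ C :=
    fun h => hτ₂.D_cut _ _ _ _ hDq h hVq
  -- the avoidance sets `U₁`, `U₂`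
  set U₁ := setPairs P τ₂ p with hU₁
  have hU₁c : U₁.card ≤ 3 * K + 7 * W := by rw [hsp]; exact hU p
  set U₂ := (Finset.range P.t).filter fun k => ((LRefVar.L (p + 1) j k).code, true) ∈ E
    with hU₂
  have hU₂c : 2 * U₂.card < P.t := hpos
  have hsn := hP.n_lt_s
  rcases Nat.eq_zero_or_pos p with rfl | hppos
  · -- parent on level 1, child on level 0
    set CL := replaceLit C ℓ true with hCL
    have hall := forall_mem_of_card hCr hCnt hℓ (by
      by_cases h : C.card < P.n
      · have := hCcard h; omega
      · omega) hCcut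
    have hCLfull : IsFullCl P.n CL := isFullCl_replaceLit hCr hCnt hℓ true hall
    obtain ⟨m, hm, hFm⟩ := hP.exists_Fc_subset hCLfull
    set U₃ := (Finset.range P.t).filter fun j' => ((LRefVar.I j' m).code, true) ∈ E with hU₃
    have hU₃c : U₃.card ≤ T := hN.icol m hm
    obtain ⟨j', hj', h1, h2, h3⟩ := exists_avoid U₁ U₂ U₃ hU₁c hU₂c hU₃c hnum
    obtain ⟨hDc, -, -, -, hIc⟩ := not_mem_setPairs h1 hj'
    have hIc := hIc rfl
    have hposL : ((LRefVar.L (0 + 1) j j').code, true) ∉ E := by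
      intro h; exact h2 (by simp only [hU₂, Finset.mem_filter, Finset.mem_range]; exact ⟨hj', h⟩)
    have hposI : ((LRefVar.I j' m).code, true) ∉ E := by
      intro h; exact h3 (by simp only [hU₃, Finset.mem_filter, Finset.mem_range]; exact ⟨hj', h⟩)
    obtain ⟨hnegI, -⟩ := exists_free_I (E := E) hj' (hC₂.not_IImp hIc)
    refine ⟨τ₂.addChildL0 j j' CL m, hτ₂.addChildL0 hP.one_lt_s hj hj' hDq hVq hDc hCLfull
      (mem_replaceLit_self C ℓ true) (fun q hq hne => mem_of_mem_replaceLit hq hne) hm hFm,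
      hE₂.trans ?_, ?_, by simp [PA.addChildL0]⟩
    · exact ((Ext.setL hL₂ j').trans (Ext.setI (σ := τ₂.setL (0 + 1, j) j') (Or.inl hIc))).trans
        (Ext.setD (σ := (τ₂.setL (0 + 1, j) j').setI j' m) hDc CL)
    · exact ((hF₂.setL hneg hposL).setI hnegI hposI).setD (hC₂.not_DMen hDc) CL
  · -- parent on level `p' + 2`, child on level `p' + 1 ≥ 1`
    obtain ⟨p', rfl⟩ : ∃ p', p = p' + 1 := ⟨p - 1, by omega⟩
    by_cases hsmall : C.card + 1 < P.n
    · -- the child clause `C ∪ {x_ℓ}`, its cut variable chosen outside it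
      obtain ⟨hℓT, hℓF⟩ := hCcut (by omega)
      set CL := insert (ℓ, true) C with hCL
      have hCLnt : NonTaut CL := nonTaut_insert hCnt (by simpa using hℓF)
      have hCLr : InRange P.n CL := inRange_insert hCr hℓ true
      have hCLcard : CL.card = C.card + 1 := Finset.card_insert_of_notMem hℓT
      obtain ⟨ℓ', hℓ', hfree⟩ := exists_not_mem_of_card_lt hCLr (by omega)
      set U₃ := (Finset.range P.t).filter fun j' => ((LRefVar.V (p' + 1) j' ℓ').code, true) ∈ E
        with hU₃
      have hU₃c : U₃.card ≤ T := hN.vcol (p' + 1) ℓ' (by omega) (by omega) hℓ'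
      obtain ⟨j', hj', h1, h2, h3⟩ := exists_avoid U₁ U₂ U₃ hU₁c hU₂c hU₃c hnum
      obtain ⟨hDc, hVc, -, -, -⟩ := not_mem_setPairs h1 hj'
      have hposL : ((LRefVar.L (p' + 1 + 1) j j').code, true) ∉ E := by
        intro h
        exact h2 (by simp only [hU₂, Finset.mem_filter, Finset.mem_range]; exact ⟨hj', h⟩)
      have hposV : ((LRefVar.V (p' + 1) j' ℓ').code, true) ∉ E := by
        intro h
        exact h3 (by simp only [hU₃, Finset.mem_filter, Finset.mem_range]; exact ⟨hj', h⟩)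
      obtain ⟨hnegV, -⟩ :=
        exists_free_V (E := E) hP.one_le_n (by omega) (by omega) hj' (hC₂.not_VImp hVc)
      refine ⟨τ₂.addChildLS p' j j' CL ℓ', hτ₂.addChildLS hp hj hj' hDq hVq hDc hCLr hCLnt
        (by simp [hCL]) (fun q hq hne => ?_) (fun _ => ?_) hℓ' (fun _ => hfree),
        hE₂.trans ?_, ?_, by simp [PA.addChildLS]⟩
      · rw [hCL, Finset.mem_insert] at hq
        exact hq.resolve_left hne
      · have := hCcard (by omega); rw [hCLcard]; omega
      · exact ((Ext.setL hL₂ j').trans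
          (Ext.setV (σ := τ₂.setL (p' + 1 + 1, j) j') (Or.inl hVc))).trans
          (Ext.setD (σ := (τ₂.setL (p' + 1 + 1, j) j').setV (p' + 1, j') ℓ') hDc CL)
      · exact ((hF₂.setL hneg hposL).setV hnegV hposV).setD (hC₂.not_DMen hDc) CL
    · -- the child clause `C[ℓ ↦ 1]` is full; its cut variable is chosen after the child
      set CL := replaceLit C ℓ true with hCL
      have hall := forall_mem_of_card hCr hCnt hℓ (by omega) hCcut
      have hCLfull : IsFullCl P.n CL := isFullCl_replaceLit hCr hCnt hℓ true hall
      obtain ⟨j', hj', h1, h2, -⟩ := exists_avoid U₁ U₂ ∅ hU₁c hU₂c (by simp) hnum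
      obtain ⟨hDc, hVc, -, -, -⟩ := not_mem_setPairs h1 hj'
      have hposL : ((LRefVar.L (p' + 1 + 1) j j').code, true) ∉ E := by
        intro h
        exact h2 (by simp only [hU₂, Finset.mem_filter, Finset.mem_range]; exact ⟨hj', h⟩)
      obtain ⟨hnegV, ℓ', hℓ', hposV⟩ :=
        exists_free_V (E := E) hP.one_le_n (by omega) (by omega) hj' (hC₂.not_VImp hVc)
      refine ⟨τ₂.addChildLS p' j j' CL ℓ', hτ₂.addChildLS hp hj hj' hDq hVq hDc hCLfull.1
        hCLfull.2.1 (mem_replaceLit_self C ℓ true)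
        (fun q hq hne => mem_of_mem_replaceLit hq hne) (fun h => ?_) hℓ' (fun h => ?_),
        hE₂.trans ?_, ?_, by simp [PA.addChildLS]⟩
      · rw [hCLfull.card_eq] at h; exact absurd h (lt_irrefl _)
      · rw [hCLfull.card_eq] at h; exact absurd h (lt_irrefl _)
      · exact ((Ext.setL hL₂ j').trans
          (Ext.setV (σ := τ₂.setL (p' + 1 + 1, j) j') (Or.inl hVc))).trans
          (Ext.setD (σ := (τ₂.setL (p' + 1 + 1, j) j').setV (p' + 1, j') ℓ') hDc CL)
      · exact ((hF₂.setL hneg hposL).setV hnegV hposV).setD (hC₂.not_DMen hDc) CL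

/-- **[Garlík 2019, Lemma 19, Case 3] for `R`.** If `R(p+1,j,·)` is unset in an admissible
assignment `σ` falsifying `E` where defined and covering `E`, which sets groups at at most
`3K + 7W` pairs per level, while `E` is `(W,T)`-narrow and `2(3K + 7W + T) + 1 ≤ t`, then `σ`
extends to an admissible assignment setting `R(p+1,j,·)` and still falsifying `E` where
defined. [cite: Garlik2019, Lemma 19 (proof, Case 3)] -/
theorem exists_setR (hP : CoreHyp P Fc) (hσ : Admissible P Fc σ) (hF : Falsi P σ E)
    (hC : Covered P σ E) (hU : ∀ i, (setPairs P σ i).card ≤ 3 * K + 7 * W)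
    (hN : Narrow P W T E) (hnum : 2 * (3 * K + 7 * W + T) + 1 ≤ P.t) {p j : ℕ}
    (hp : p + 1 < P.s) (hj : j < P.t) (hL : σ.R (p + 1, j) = none) :
    ∃ τ : PA, Admissible P Fc τ ∧ Ext σ τ ∧ Falsi P τ E ∧ τ.R (p + 1, j) ≠ none := by
  classical
  -- the pair is not `R`-important: no negative and fewer than `t/2` positive `R`-literals
  have hnL : ¬ RImp P E (p + 1) j := hC.not_RImp hL
  simp only [RImp, not_and, not_or, not_le] at hnL
  obtain ⟨hneg, hpos⟩ := hnL (by omega) hp hj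
  -- Step 1: the parent clause and cut variable
  obtain ⟨τ₂, hτ₂, hE₂, hF₂, hC₂, ⟨C, ℓ, hDq, hVq⟩, -, hL₂, hsp⟩ :=
    exists_parent hP hσ hF hC hp hj
  rw [hL] at hL₂
  have hCr : InRange P.n C := (hτ₂.D_range _ _ _ hDq).2.2
  have hCnt : NonTaut C := hτ₂.D_nonTaut _ _ _ hDq
  have hℓ : ℓ < P.n := (hτ₂.V_range _ _ _ hVq).2.2.2
  have hCcard : C.card < P.n → P.s ≤ p + 1 + 1 + C.card := hτ₂.D_card _ _ _ hDq
  have hCcut : C.card < P.n → (ℓ, true) ∉ C ∧ (ℓ, false) ∉ C :=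
    fun h => hτ₂.D_cut _ _ _ _ hDq h hVq
  -- the avoidance sets `U₁`, `U₂`
  set U₁ := setPairs P τ₂ p with hU₁
  have hU₁c : U₁.card ≤ 3 * K + 7 * W := by rw [hsp]; exact hU p
  set U₂ := (Finset.range P.t).filter fun k => ((LRefVar.R (p + 1) j k).code, true) ∈ E
    with hU₂
  have hU₂c : 2 * U₂.card < P.t := hpos
  have hsn := hP.n_lt_s
  rcases Nat.eq_zero_or_pos p with rfl | hppos
  · -- parent on level 1, child on level 0
    set CL := replaceLit C ℓ false with hCL
    have hall := forall_mem_of_card hCr hCnt hℓ (by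
      by_cases h : C.card < P.n
      · have := hCcard h; omega
      · omega) hCcut
    have hCLfull : IsFullCl P.n CL := isFullCl_replaceLit hCr hCnt hℓ false hall
    obtain ⟨m, hm, hFm⟩ := hP.exists_Fc_subset hCLfull
    set U₃ := (Finset.range P.t).filter fun j' => ((LRefVar.I j' m).code, true) ∈ E with hU₃
    have hU₃c : U₃.card ≤ T := hN.icol m hm
    obtain ⟨j', hj', h1, h2, h3⟩ := exists_avoid U₁ U₂ U₃ hU₁c hU₂c hU₃c hnum
    obtain ⟨hDc, -, -, -, hIc⟩ := not_mem_setPairs h1 hj'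
    have hIc := hIc rfl
    have hposL : ((LRefVar.R (0 + 1) j j').code, true) ∉ E := by
      intro h; exact h2 (by simp only [hU₂, Finset.mem_filter, Finset.mem_range]; exact ⟨hj', h⟩)
    have hposI : ((LRefVar.I j' m).code, true) ∉ E := by
      intro h; exact h3 (by simp only [hU₃, Finset.mem_filter, Finset.mem_range]; exact ⟨hj', h⟩)
    obtain ⟨hnegI, -⟩ := exists_free_I (E := E) hj' (hC₂.not_IImp hIc)
    refine ⟨τ₂.addChildR0 j j' CL m, hτ₂.addChildR0 hP.one_lt_s hj hj' hDq hVq hDc hCLfull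
      (mem_replaceLit_self C ℓ false) (fun q hq hne => mem_of_mem_replaceLit hq hne) hm hFm,
      hE₂.trans ?_, ?_, by simp [PA.addChildR0]⟩
    · exact ((Ext.setR hL₂ j').trans (Ext.setI (σ := τ₂.setR (0 + 1, j) j') (Or.inl hIc))).trans
        (Ext.setD (σ := (τ₂.setR (0 + 1, j) j').setI j' m) hDc CL)
    · exact ((hF₂.setR hneg hposL).setI hnegI hposI).setD (hC₂.not_DMen hDc) CL
  · -- parent on level `p' + 2`, child on level `p' + 1 ≥ 1`
    obtain ⟨p', rfl⟩ : ∃ p', p = p' + 1 := ⟨p - 1, by omega⟩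
    by_cases hsmall : C.card + 1 < P.n
    · -- the child clause `C ∪ {¬x_ℓ}`, its cut variable chosen outside it
      obtain ⟨hℓT, hℓF⟩ := hCcut (by omega)
      set CL := insert (ℓ, false) C with hCL
      have hCLnt : NonTaut CL := nonTaut_insert hCnt (by simpa using hℓT)
      have hCLr : InRange P.n CL := inRange_insert hCr hℓ false
      have hCLcard : CL.card = C.card + 1 := Finset.card_insert_of_notMem hℓF
      obtain ⟨ℓ', hℓ', hfree⟩ := exists_not_mem_of_card_lt hCLr (by omega)
      set U₃ := (Finset.range P.t).filter fun j' => ((LRefVar.V (p' + 1) j' ℓ').code, true) ∈ E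
        with hU₃
      have hU₃c : U₃.card ≤ T := hN.vcol (p' + 1) ℓ' (by omega) (by omega) hℓ'
      obtain ⟨j', hj', h1, h2, h3⟩ := exists_avoid U₁ U₂ U₃ hU₁c hU₂c hU₃c hnum
      obtain ⟨hDc, hVc, -, -, -⟩ := not_mem_setPairs h1 hj'
      have hposL : ((LRefVar.R (p' + 1 + 1) j j').code, true) ∉ E := by
        intro h
        exact h2 (by simp only [hU₂, Finset.mem_filter, Finset.mem_range]; exact ⟨hj', h⟩)
      have hposV : ((LRefVar.V (p' + 1) j' ℓ').code, true) ∉ E := by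
        intro h
        exact h3 (by simp only [hU₃, Finset.mem_filter, Finset.mem_range]; exact ⟨hj', h⟩)
      obtain ⟨hnegV, -⟩ :=
        exists_free_V (E := E) hP.one_le_n (by omega) (by omega) hj' (hC₂.not_VImp hVc)
      refine ⟨τ₂.addChildRS p' j j' CL ℓ', hτ₂.addChildRS hp hj hj' hDq hVq hDc hCLr hCLnt
        (by simp [hCL]) (fun q hq hne => ?_) (fun _ => ?_) hℓ' (fun _ => hfree),
        hE₂.trans ?_, ?_, by simp [PA.addChildRS]⟩
      · rw [hCL, Finset.mem_insert] at hq
        exact hq.resolve_left hne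
      · have := hCcard (by omega); rw [hCLcard]; omega
      · exact ((Ext.setR hL₂ j').trans
          (Ext.setV (σ := τ₂.setR (p' + 1 + 1, j) j') (Or.inl hVc))).trans
          (Ext.setD (σ := (τ₂.setR (p' + 1 + 1, j) j').setV (p' + 1, j') ℓ') hDc CL)
      · exact ((hF₂.setR hneg hposL).setV hnegV hposV).setD (hC₂.not_DMen hDc) CL
    · -- the child clause `C[ℓ ↦ 0]` is full; its cut variable is chosen after the child
      set CL := replaceLit C ℓ false with hCL
      have hall := forall_mem_of_card hCr hCnt hℓ (by omega) hCcut
      have hCLfull : IsFullCl P.n CL := isFullCl_replaceLit hCr hCnt hℓ false hall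
      obtain ⟨j', hj', h1, h2, -⟩ := exists_avoid U₁ U₂ ∅ hU₁c hU₂c (by simp) hnum
      obtain ⟨hDc, hVc, -, -, -⟩ := not_mem_setPairs h1 hj'
      have hposL : ((LRefVar.R (p' + 1 + 1) j j').code, true) ∉ E := by
        intro h
        exact h2 (by simp only [hU₂, Finset.mem_filter, Finset.mem_range]; exact ⟨hj', h⟩)
      obtain ⟨hnegV, ℓ', hℓ', hposV⟩ :=
        exists_free_V (E := E) hP.one_le_n (by omega) (by omega) hj' (hC₂.not_VImp hVc)
      refine ⟨τ₂.addChildRS p' j j' CL ℓ', hτ₂.addChildRS hp hj hj' hDq hVq hDc hCLfull.1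
        hCLfull.2.1 (mem_replaceLit_self C ℓ false)
        (fun q hq hne => mem_of_mem_replaceLit hq hne) (fun h => ?_) hℓ' (fun h => ?_),
        hE₂.trans ?_, ?_, by simp [PA.addChildRS]⟩
      · rw [hCLfull.card_eq] at h; exact absurd h (lt_irrefl _)
      · rw [hCLfull.card_eq] at h; exact absurd h (lt_irrefl _)
      · exact ((Ext.setR hL₂ j').trans
          (Ext.setV (σ := τ₂.setR (p' + 1 + 1, j) j') (Or.inl hVc))).trans
          (Ext.setD (σ := (τ₂.setR (p' + 1 + 1, j) j').setV (p' + 1, j') ℓ') hDc CL)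
      · exact ((hF₂.setR hneg hposL).setV hnegV hposV).setD (hC₂.not_DMen hDc) CL

end SetPrem

/-! ### Lemma 19: the backward step -/

section Step

variable {P : Params} {Fc : ℕ → Finset (ℕ × Bool)} {ρ : PA} {K W T : ℕ}

/-- **[Garlík 2019, Lemma 19].** Let `ρ` be admissible and `K`-sparse per level, and let
`2(3K + 7W + T) + 1 ≤ t`. If the conclusion `E` of a resolution inference `E₀, E₁ ⊢ E` is
`(W,T)`-narrow and good (some admissible extension of `ρ` falsifies `E` where defined and
covers `E`), then one of the premises is good. Proof: clean up the good assignment; if the pivot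
is junk, out of range, or assigned, nothing needs to be done; otherwise extend by the group of
the pivot — a cut variable or an `F`-clause (Case 1), a clause (Case 2), a premise with a fresh
child (Case 3) — and take the premise on which the pivot gets the falsified polarity.
[cite: Garlik2019, Lemma 19] -/
theorem step (hP : CoreHyp P Fc) (hK : LevelSparse P K ρ)
    (hnum : 2 * (3 * K + 7 * W + T) + 1 ≤ P.t) {E₀ E₁ E : Finset (Literal ℕ)} {Q : ℕ}
    (hres : IsResolvent E₀ E₁ Q E) (hN : Narrow P W T E) (hG : Good P Fc ρ E) :
    Good P Fc ρ E₀ ∨ Good P Fc ρ E₁ := by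
  classical
  obtain ⟨σ, hσ, hρσ, hFσ, hCσ⟩ := hG
  -- the cleanup
  set σ₁ := clean P E ρ σ with hσ₁def
  have hσ₁ : Admissible P Fc σ₁ := hσ.clean
  have hρ₁ : Ext ρ σ₁ := hρσ.clean
  have hF₁ : Falsi P σ₁ E := hFσ.clean
  have hC₁ : Covered P σ₁ E := hCσ.clean
  have hU : ∀ i, (setPairs P σ₁ i).card ≤ 3 * K + 7 * W :=
    fun i => card_setPairs_clean_le hσ hK hN i
  -- junk pivot
  by_cases hQ : ∃ x : LRefVar, x.code = Q
  swap
  · push Not at hQ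
    exact finish_junk hres hσ₁ hρ₁ hF₁ hC₁ hQ
  obtain ⟨x, hx⟩ := hQ
  cases x with
  | D i j ℓ b =>
    by_cases hr : i < P.s ∧ j < P.t ∧ ℓ < P.n
    · obtain ⟨hi, hj, hℓ⟩ := hr
      -- Case 2 (or nothing to do): make sure the clause of `(i, j)` is set
      obtain ⟨τ, hτ, hE, hFτ, hDτ⟩ : ∃ τ : PA, Admissible P Fc τ ∧ Ext σ₁ τ ∧ Falsi P τ E ∧
          τ.D (i, j) ≠ none := by
        cases hD : σ₁.D (i, j) with
        | some C => exact ⟨σ₁, hσ₁, Ext.refl _, hF₁, by rw [hD]; simp⟩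
        | none =>
          obtain ⟨τ, hτ, hE, hFτ, hDτ, -, -⟩ := exists_fillD hP hσ₁ hF₁ hC₁ hi hj hD
          exact ⟨τ, hτ, hE, hFτ, hDτ⟩
      obtain ⟨C, hC⟩ := Option.ne_none_iff_exists'.1 hDτ
      exact finish_of_value hres hτ (hρ₁.trans hE) hFτ (hC₁.ext hE) hx (PA.eval_D hC hi hj hℓ)
        fun _ _ _ _ => hDτ
    · exact finish hres hσ₁ hρ₁ hF₁ hC₁ hx true (fun hi hj hℓ => absurd ⟨hi, hj, hℓ⟩ hr)
        (by simp [PA.eval, hr])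
  | V i j ℓ =>
    by_cases hr : 1 ≤ i ∧ i < P.s ∧ j < P.t ∧ ℓ < P.n
    · obtain ⟨h1, hi, hj, hℓ⟩ := hr
      obtain ⟨p, rfl⟩ : ∃ p, i = p + 1 := ⟨i - 1, by omega⟩
      -- Case 1 (or nothing to do): make sure the cut variable of `(p+1, j)` is set
      obtain ⟨τ, hτ, hE, hFτ, hVτ⟩ : ∃ τ : PA, Admissible P Fc τ ∧ Ext σ₁ τ ∧ Falsi P τ E ∧
          τ.V (p + 1, j) ≠ none := by
        cases hV : σ₁.V (p + 1, j) with
        | some k => exact ⟨σ₁, hσ₁, Ext.refl _, hF₁, by rw [hV]; simp⟩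
        | none =>
          have hD : σ₁.D (p + 1, j) = none := by
            cases hD' : σ₁.D (p + 1, j) with
            | none => rfl
            | some C => exact absurd hV (hσ₁.D_V p j (by rw [hD']; simp))
          obtain ⟨hneg, k, hk, hpos⟩ := exists_free_V hP.one_le_n h1 hi hj (hC₁.not_VImp hV)
          exact ⟨σ₁.setV (p + 1, j) k, hσ₁.setV hD hi hj hk, Ext.setV (Or.inl hV),
            hF₁.setV hneg hpos, by simp⟩
      obtain ⟨k, hk⟩ := Option.ne_none_iff_exists'.1 hVτ
      exact finish_of_value hres hτ (hρ₁.trans hE) hFτ (hC₁.ext hE) hx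
        (PA.eval_V hk h1 hi hj hℓ) fun _ _ _ => hVτ
    · exact finish hres hσ₁ hρ₁ hF₁ hC₁ hx true
        (fun hℓ himp => absurd ⟨himp.1, himp.2.1, himp.2.2.1, hℓ⟩ hr) (by simp [PA.eval, hr])
  | I j m =>
    by_cases hr : j < P.t ∧ m < P.r
    · obtain ⟨hj, hm⟩ := hr
      -- Case 1 (or nothing to do): make sure the `F`-clause index of `(0, j)` is set
      obtain ⟨τ, hτ, hE, hFτ, hIτ⟩ : ∃ τ : PA, Admissible P Fc τ ∧ Ext σ₁ τ ∧ Falsi P τ E ∧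
          τ.I j ≠ none := by
        cases hI : σ₁.I j with
        | some k => exact ⟨σ₁, hσ₁, Ext.refl _, hF₁, by rw [hI]; simp⟩
        | none =>
          have hD : σ₁.D (0, j) = none := by
            cases hD' : σ₁.D (0, j) with
            | none => rfl
            | some C => exact absurd hI (hσ₁.D_I j (by rw [hD']; simp))
          obtain ⟨hneg, k, hk, hpos⟩ := exists_free_I hj (hC₁.not_IImp hI)
          exact ⟨σ₁.setI j k, hσ₁.setI hD hj hk, Ext.setI (Or.inl hI), hF₁.setI hneg hpos,
            by simp⟩
      obtain ⟨k, hk⟩ := Option.ne_none_iff_exists'.1 hIτ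
      exact finish_of_value hres hτ (hρ₁.trans hE) hFτ (hC₁.ext hE) hx (PA.eval_I hk hj hm)
        fun _ _ _ => hIτ
    · exact finish hres hσ₁ hρ₁ hF₁ hC₁ hx true (fun hm himp => absurd ⟨himp.1, hm⟩ hr)
        (by simp [PA.eval, hr])
  | L i j k =>
    by_cases hr : 1 ≤ i ∧ i < P.s ∧ j < P.t ∧ k < P.t
    · obtain ⟨h1, hi, hj, hk⟩ := hr
      obtain ⟨p, rfl⟩ : ∃ p, i = p + 1 := ⟨i - 1, by omega⟩
      -- Case 3 (or nothing to do): make sure the `L`-premise of `(p+1, j)` is set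
      obtain ⟨τ, hτ, hE, hFτ, hLτ⟩ : ∃ τ : PA, Admissible P Fc τ ∧ Ext σ₁ τ ∧ Falsi P τ E ∧
          τ.L (p + 1, j) ≠ none := by
        cases hL : σ₁.L (p + 1, j) with
        | some k' => exact ⟨σ₁, hσ₁, Ext.refl _, hF₁, by rw [hL]; simp⟩
        | none => exact exists_setL hP hσ₁ hF₁ hC₁ hU hN hnum hi hj hL
      obtain ⟨k', hk'⟩ := Option.ne_none_iff_exists'.1 hLτ
      exact finish_of_value hres hτ (hρ₁.trans hE) hFτ (hC₁.ext hE) hx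
        (PA.eval_L hk' h1 hi hj hk) fun _ _ _ => hLτ
    · exact finish hres hσ₁ hρ₁ hF₁ hC₁ hx true
        (fun hk himp => absurd ⟨himp.1, himp.2.1, himp.2.2.1, hk⟩ hr) (by simp [PA.eval, hr])
  | R i j k =>
    by_cases hr : 1 ≤ i ∧ i < P.s ∧ j < P.t ∧ k < P.t
    · obtain ⟨h1, hi, hj, hk⟩ := hr
      obtain ⟨p, rfl⟩ : ∃ p, i = p + 1 := ⟨i - 1, by omega⟩
      -- Case 3 (or nothing to do): make sure the `R`-premise of `(p+1, j)` is set
      obtain ⟨τ, hτ, hE, hFτ, hRτ⟩ : ∃ τ : PA, Admissible P Fc τ ∧ Ext σ₁ τ ∧ Falsi P τ E ∧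
          τ.R (p + 1, j) ≠ none := by
        cases hR : σ₁.R (p + 1, j) with
        | some k' => exact ⟨σ₁, hσ₁, Ext.refl _, hF₁, by rw [hR]; simp⟩
        | none => exact exists_setR hP hσ₁ hF₁ hC₁ hU hN hnum hi hj hR
      obtain ⟨k', hk'⟩ := Option.ne_none_iff_exists'.1 hRτ
      exact finish_of_value hres hτ (hρ₁.trans hE) hFτ (hC₁.ext hE) hx
        (PA.eval_R hk' h1 hi hj hk) fun _ _ _ => hRτ
    · exact finish hres hσ₁ hρ₁ hF₁ hC₁ hx true
        (fun hk himp => absurd ⟨himp.1, himp.2.1, himp.2.2.1, hk⟩ hr) (by simp [PA.eval, hr])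

end Step

/-! ### The deterministic core -/

section Core

variable {P : Params} {Fc : ℕ → Finset (ℕ × Bool)} {ρ : PA} {K W T : ℕ}

/-- The empty clause has no positive literals. [folklore] -/
theorem posCnt_empty (f : ℕ → LRefVar) (N : ℕ) : posCnt ∅ f N = 0 := by
  classical
  simp [posCnt]

/-- The empty clause mentions nothing and has no important pairs (for `n, r, t ≥ 1`), so any
assignment covers it. [folklore] -/
theorem covered_empty (hn : 1 ≤ P.n) (hr : 1 ≤ P.r) (ht : 1 ≤ P.t) (σ : PA) : Covered P σ ∅ := by
  refine ⟨fun i j hm => ?_, fun i j hm => ?_, fun j hm => ?_, fun i j hm => ?_, fun i j hm => ?_⟩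
  · obtain ⟨-, -, ℓ, -, b, c, h⟩ := hm; simp at h
  · rcases hm.2.2.2 with ⟨k, -, h⟩ | h
    · simp at h
    · rw [posCnt_empty] at h; omega
  · rcases hm.2 with ⟨k, -, h⟩ | h
    · simp at h
    · rw [posCnt_empty] at h; omega
  · rcases hm.2.2.2 with ⟨k, -, h⟩ | h
    · simp at h
    · rw [posCnt_empty] at h; omega
  · rcases hm.2.2.2 with ⟨k, -, h⟩ | h
    · simp at h
    · rw [posCnt_empty] at h; omega

/-- The restriction itself is good for the empty clause ([Garlík 2019, Lemma 17]: an admissible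
assignment exists — here `ρ` is admissible by hypothesis). [cite: Garlik2019, Lemma 17] -/
theorem good_empty (hP : CoreHyp P Fc) (hρ : Admissible P Fc ρ) : Good P Fc ρ ∅ :=
  ⟨ρ, hρ, Ext.refl ρ, fun x b h => absurd h (Finset.notMem_empty _),
    covered_empty hP.one_le_n hP.one_le_r (by have := hP.n_lt_s; have := hP.s_le_t; omega) ρ⟩

/-- **The deterministic core of [Garlík 2019, Thm 7].** Let the CNF `φ` consist of
(`code`-images of) axioms of `REF^F_{s,t}`, and let `ρ` be an admissible restriction that is
`K`-sparse on every level, with `2(3K + 7W + T) + 1 ≤ t`. Then `φ` has no resolution refutation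
all of whose clauses are satisfied by `ρ` or `(W,T)`-narrow. (Walk back from the empty clause
— good by Lemma 17 — through the refutation with Lemma 19, reaching an axiom, which cannot be
good by Lemma 16.) [cite: Garlik2019, Thm 7 (proof, §4)] -/
theorem core_contradiction (hP : CoreHyp P Fc) (hρ : Admissible P Fc ρ) (hK : LevelSparse P K ρ)
    (hnum : 2 * (3 * K + 7 * W + T) + 1 ≤ P.t) {φ : CNF ℕ}
    (hax : ∀ C ∈ φ.clauseFinsets, ∃ c, IsAxiom P.n P.r P.s P.t Fc c ∧ C = codeClause c)
    {π : List (ResLine ℕ)} (hπ : IsResRefutation φ π)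
    (hN : ∀ E ∈ π.map ResLine.clause, ¬ SatBy P ρ E → Narrow P W T E) : False := by
  refine no_refutation_of_invariant hπ (Good P Fc ρ) (fun C hC hG => ?_)
    (fun C D E v _ _ hE hres hG => ?_) (fun C E _ _ hCE hG => hG.mono hCE) (good_empty hP hρ)
  · obtain ⟨c, hc, rfl⟩ := hax C hC
    obtain ⟨σ, hσ, -, hF, hCov⟩ := hG
    exact not_axiom_of_covered hσ (by have := hP.n_lt_s; omega) hP.Fc_range hc hF hCov
  · have hns : ¬ SatBy P ρ E := by
      obtain ⟨σ, -, hρσ, hF, -⟩ := hG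
      exact hF.not_satBy hρσ
    exact step hP hK hnum hres (hN E hE hns) hG

/-- The parameters of `REF^F_{s,t}` for `levelledRefCNF F s t`: `n = |vars F|`, `r = |F|`.
[cite: Garlik2019, §3] -/
def params (F : CNF ℕ) (s t : ℕ) : Params :=
  ⟨(CNF.vars F).card, F.length, s, t⟩

/-- Unfolding `params`. [folklore] -/
@[simp] theorem params_n (F : CNF ℕ) (s t : ℕ) : (params F s t).n = (CNF.vars F).card := rfl
/-- Unfolding `params`. [folklore] -/
@[simp] theorem params_r (F : CNF ℕ) (s t : ℕ) : (params F s t).r = F.length := rfl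
/-- Unfolding `params`. [folklore] -/
@[simp] theorem params_s (F : CNF ℕ) (s t : ℕ) : (params F s t).s = s := rfl
/-- Unfolding `params`. [folklore] -/
@[simp] theorem params_t (F : CNF ℕ) (s t : ℕ) : (params F s t).t = t := rfl

/-- The standing hypotheses hold for `levelledRefCNF F s t` when `F` is an unsatisfiable CNF with
non-tautological clauses in `n ≥ 1` variables and `t ≥ s ≥ n + 1`. [cite: Garlik2019, Thm 7
(hypotheses)] -/
theorem coreHyp_params {F : CNF ℕ} {s t : ℕ} (hn : 1 ≤ (CNF.vars F).card)
    (hs : (CNF.vars F).card + 1 ≤ s) (hst : s ≤ t) (hnt : ∀ C ∈ F.clauseFinsets, IsNonTaut C)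
    (hunsat : ¬ F.Satisfiable) : CoreHyp (params F s t) (fclause (sortedVars F) F) where
  one_le_n := hn
  n_lt_s := hs
  s_le_t := hst
  Fc_range m _ := fclause_subset F m
  Fc_nonTaut m _ ℓ := fclause_nonTaut hnt m ℓ
  Fc_unsat c := exists_fclause_subset_of_not_satisfiable hunsat c

/-- **The deterministic core for `levelledRefCNF F s t`**: given an admissible, per-level
`K`-sparse restriction `ρ` of `REF^F_{s,t}` (`F` unsatisfiable with non-tautological clauses,
`n ≥ 1`, `t ≥ s ≥ n + 1`, `2(3K + 7W + T) + 1 ≤ t`), no resolution refutation of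
`levelledRefCNF F s t` has all its clauses satisfied by `ρ` or `(W,T)`-narrow.
[cite: Garlik2019, Thm 7 (proof, §4)] -/
theorem levelledRefCNF_core {F : CNF ℕ} {s t K W T : ℕ} (hn : 1 ≤ (CNF.vars F).card)
    (hs : (CNF.vars F).card + 1 ≤ s) (hst : s ≤ t) (hnt : ∀ C ∈ F.clauseFinsets, IsNonTaut C)
    (hunsat : ¬ F.Satisfiable) {ρ : PA} (hρ : Admissible (params F s t) (fclause (sortedVars F) F) ρ)
    (hK : LevelSparse (params F s t) K ρ) (hnum : 2 * (3 * K + 7 * W + T) + 1 ≤ t)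
    {π : List (ResLine ℕ)} (hπ : IsResRefutation (levelledRefCNF F s t) π)
    (hN : ∀ E ∈ π.map ResLine.clause, ¬ SatBy (params F s t) ρ E → Narrow (params F s t) W T E) :
    False := by
  refine core_contradiction (coreHyp_params hn hs hst hnt hunsat) hρ hK hnum (fun C hC => ?_) hπ hN
  obtain ⟨c, hc, rfl⟩ := mem_clauseFinsets_levelledRefCNF.1 hC
  refine ⟨c, ?_, rfl⟩
  have := isAxiom_of_mem_lref hc
  rwa [length_sortedVars] at this

end Core




end LevelledRefCNF

end Literature.Computability.MetaComplexity
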